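import Literature.Probability.RandomPlanarGeometry.SAWPulledRenewalGapTilts
import Literature.Probability.RandomPlanarGeometry.SAWTubeBridges
import Literature.Probability.Moments.KilledWalkTubeEstimates
import Literature.Probability.RandomPlanarGeometry.SAWMaxHeightUnfolding
import Literature.Probability.RandomPlanarGeometry.SAWKestenRelation
import HarnessLib

/-!
# The `T⁻²` law for the confinement deficit of pulled self-avoiding bridges in a strip (lane «pcv-sawmu», route R51 «STRIP-DEFICIT»)

Topic `Literature/Probability/RandomPlanarGeometry`. **Computational lineage**: the parametric theorems inherit
`FiniteMemory.checkC_18_2688` (`native_decide`, the certified `μ(ℤ²) ≤ 2.688` finite-memory bound) through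
`SAWPulledRenewalGapTilts` ← `pulledBlockLaw_le_geometric`; the file is declared `computational` for that reason only.

## What is proved
Confine `N`-step bridges on `ℤ²`, pulled at force `y` along `e₀`, to the transversal strip `|x₁| ≤ T` (`stripBridges`,
`pulledStripZ T N y = Σ y^{span}`). Under the pulled renewal GAP condition at `y` (certified in the tree at `y = 2` and along the
tilt ladder of `SAWPulledRenewalGapTilts`), the confinement DEFICIT of the free energy obeys a two-sided `T⁻²` law with explicit
constants (`StripDeficitUpper`, `StripDeficitLower`):
  `c/T² ≤ λ_B(y) − λ^{strip}_{B,T}(y) ≤ C/T²`   (`T ≥ T₀` on the right),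
`stripDeficitLower_of_gap`, `stripDeficitUpper_of_gap`, and unconditionally at `y = 2`: **`stripDeficit_two`**.

Mechanism: a pulled bridge at a gapped tilt is a renewal chain of irreducible pieces whose transversal displacements form an
i.i.d. symmetric finitely-supported step law (`blockLaw`, S1/S2: symmetry by the reflection `x₁ ↦ −x₁`, moments against the tilted
block-length law, variance from the two 2-step pieces); a strip bridge's renewal heights perform a walk killed outside the tube
(S3: `stub_strip_le_tube` — strip bridges inject into tube paths, via the first-renewal bijection and the backward recursion of the
killed kernel of `KilledWalkTubeEstimates`; `stub_tube_le_strip` — tube paths of pieces of length `≤ I` with `R + I ≤ T` are distinct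
strip bridges, cumulative in the number of pieces); the killed-walk tube estimates (`StepLaw.tube_upper` / `not_summable_tubeMassK` of
`KilledWalkTubeEstimates`, Kolmogorov / Paley–Zygmund) then give the two deficit bounds grand-canonically.

Printed status: no rate theorem for a confined self-avoiding free energy exists in print; the unforced prediction is
`log μ − log μ_w ≍ w^{−1/ν}` [cite: DaoudDeGennes1977] (numerics: Guttmann–Jensen), existence and strict monotonicity without rate are
[cite: MadrasSlade1993, Theorem 8.2.1] [cite: SoterosWhittington1988] [cite: AlmJanson1990]; the `T⁻²` law proved here is the
directed-path (Dirichlet eigenvalue) law [cite: BrakOwczarekRechnitzerWhittington2005, §6–§7, κ(w;1,1) = log 2cos(π/(w+2))] transported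
to pulled self-avoiding bridges through the renewal structure of the ballistic phase [cite: IoffeVelenik2008].

Lane record: route R51 (a-idea-1 ROUTES-G10/G11, skeleton and analytic assembly (L)/(U)/(y = 2) by a-idea-1 g10–g11), stubs S1/S2 by
a-p6 g3, stubs S3a/S3b and the killed-kernel backward recursion by a-p4 g4; abstract tube estimates = text (D)
`Literature.Probability.Moments.KilledWalkTubeEstimates` (a-idea-1, filed by a-p1). Tree-twin search: stems `stripBridges`, `pulledStripZ`,
`StripDeficit`, `blockLaw` → none outside this file. No twin.
-/

noncomputable section

open Finset Filter Topology
open scoped BigOperators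
open Literature.Probability.LatticeModels
open Literature.Probability.RandomPlanarGeometry.SAW
open Literature.Probability.Moments.KilledWalkTube

/-! ### a-p4 g4: the backward recursion of the killed kernel of `KilledWalkTubeEstimates` (for S3a) -/

namespace Literature.Probability.Moments.KilledWalkTube.StepLaw

variable (L : StepLaw)

/-- `stepK` is additive in the density. [cite: Durrett2019, Theorem 2.5.5 (killed random walk kernels; linearity)] -/
theorem stepK_add' (R : ℕ) (f g : ℤ → ℝ) : L.stepK R (fun z => f z + g z) = fun b => L.stepK R f b + L.stepK R g b := by
  funext b
  unfold stepK
  split_ifs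
  · rw [← Finset.sum_add_distrib]; exact Finset.sum_congr rfl fun a _ => by ring
  · simp

/-- `stepK` is homogeneous in the density. [cite: Durrett2019, Theorem 2.5.5 (killed random walk kernels; linearity)] -/
theorem stepK_const_mul' (R : ℕ) (c : ℝ) (f : ℤ → ℝ) :
    L.stepK R (fun z => c * f z) = fun b => c * L.stepK R f b := by
  funext b
  unfold stepK
  split_ifs
  · rw [Finset.mul_sum]; exact Finset.sum_congr rfl fun a _ => by ring
  · simp

/-- `stepK` of the zero density. [cite: Durrett2019, Theorem 2.5.5] -/
theorem stepK_zero' (R : ℕ) : L.stepK R (fun _ => 0) = fun _ => 0 := by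
  funext b; unfold stepK; split_ifs <;> simp

/-- `stepK` of a finite sum of densities. [cite: Durrett2019, Theorem 2.5.5] -/
theorem stepK_finset_sum {ι : Type*} (R : ℕ) (s : Finset ι) (F : ι → ℤ → ℝ) :
    L.stepK R (fun z => ∑ i ∈ s, F i z) = fun b => ∑ i ∈ s, L.stepK R (F i) b := by
  classical
  induction s using Finset.induction_on with
  | empty => simp only [Finset.sum_empty]; exact L.stepK_zero' R
  | @insert i s hi ih =>
    simp only [Finset.sum_insert hi]
    rw [stepK_add', ih]

/-- `iterK` of a finite sum of densities. [cite: Durrett2019, Theorem 2.5.5] -/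
theorem iterK_finset_sum {ι : Type*} (R : ℕ) (s : Finset ι) (F : ι → ℤ → ℝ) :
    ∀ n, L.iterK R n (fun z => ∑ i ∈ s, F i z) = fun b => ∑ i ∈ s, L.iterK R n (F i) b := by
  intro n
  induction n with
  | zero => rfl
  | succ n ih =>
    unfold iterK at ih ⊢
    rw [Function.iterate_succ_apply', ih, stepK_finset_sum]
    simp only [Function.iterate_succ_apply']

/-- `iterK` is homogeneous. [cite: Durrett2019, Theorem 2.5.5] -/
theorem iterK_const_mul' (R : ℕ) (c : ℝ) (f : ℤ → ℝ) :
    ∀ n, L.iterK R n (fun z => c * f z) = fun b => c * L.iterK R n f b := by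
  intro n
  induction n with
  | zero => rfl
  | succ n ih =>
    unfold iterK at ih ⊢
    rw [Function.iterate_succ_apply', ih, stepK_const_mul']
    simp only [Function.iterate_succ_apply']

/-- `iterK` of the zero density. [cite: Durrett2019, Theorem 2.5.5] -/
theorem iterK_zero' (R : ℕ) : ∀ n, L.iterK R n (fun _ => (0 : ℝ)) = fun _ => 0 := by
  intro n
  induction n with
  | zero => rfl
  | succ n ih => unfold iterK at ih ⊢; rw [Function.iterate_succ_apply, stepK_zero', ih]

/-- One killed step from a point mass: `stepK (δ_s) = [s ∈ box] Σ_z μ(z) [s+z ∈ box] δ_{s+z}`.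
[cite: Durrett2019, Theorem 2.5.5 (killed random walk kernels)] -/
theorem stepK_delta (R : ℕ) (s : ℤ) : L.stepK R (delta s) = fun b =>
    ∑ z ∈ L.S, ((if s ∈ box R then 1 else 0) * (if s + z ∈ box R then 1 else 0) * L.μ z) * delta (s + z) b := by
  classical
  funext b
  unfold stepK delta
  by_cases hb : b ∈ box R
  · rw [if_pos hb]
    by_cases hs : s ∈ box R
    · -- the left sum is `μ(b - s)`
      have hl : ∑ a ∈ box R, (if a = s then (1 : ℝ) else 0) * L.μ (b - a) = L.μ (b - s) := by
        rw [Finset.sum_eq_single s (fun a _ ha => by rw [if_neg ha, zero_mul]) (fun h => absurd hs h)]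
        simp
      -- the right sum is `μ(b - s)` too: only `z = b - s` contributes
      have hr : ∑ z ∈ L.S, ((if s ∈ box R then 1 else 0) * (if s + z ∈ box R then 1 else 0) * L.μ z) *
          (if b = s + z then (1 : ℝ) else 0) = L.μ (b - s) := by
        rw [Finset.sum_eq_single (b - s)]
        · simp [hs, hb]
        · intro z _ hz
          have : b ≠ s + z := fun h => hz (by rw [h]; ring)
          rw [if_neg this, mul_zero]
        · intro hz
          rw [L.supp _ hz]; simp
      rw [hl, hr]
    · have hl : ∑ a ∈ box R, (if a = s then (1 : ℝ) else 0) * L.μ (b - a) = 0 := by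
        refine Finset.sum_eq_zero fun a ha => ?_
        have has : a ≠ s := fun h => hs (by rw [← h]; exact ha)
        rw [if_neg has, zero_mul]
      rw [hl]
      symm
      exact Finset.sum_eq_zero fun z _ => by simp [hs]
  · rw [if_neg hb]
    symm
    refine Finset.sum_eq_zero fun z _ => ?_
    by_cases h : b = s + z
    · have : s + z ∉ box R := h ▸ hb
      simp [this]
    · rw [if_neg h, mul_zero]

/-- `Λ` of a point mass. [cite: Durrett2019, Theorem 2.5.5] -/
theorem Λ_delta' (R : ℕ) (s : ℤ) : Λ R (delta s) = if s ∈ box R then 1 else 0 := by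
  classical
  unfold Λ delta
  exact Finset.sum_ite_eq' (box R) s (fun _ => (1 : ℝ))

/-- Killed kernels vanish from a start outside the box (one or more steps). [cite: Durrett2019, Theorem 2.5.5] -/
theorem iterK_delta_of_not_mem {R : ℕ} {s : ℤ} (hs : s ∉ box R) (n : ℕ) :
    L.iterK R (n + 1) (delta s) = fun _ => 0 := by
  have h1 : L.stepK R (delta s) = fun _ => 0 := by
    rw [stepK_delta]; funext b
    simp [hs]
  unfold iterK
  rw [Function.iterate_succ_apply, h1]
  exact L.iterK_zero' R n

/-- **The backward recursion** of the tube mass `W_n(s) = Λ_R(K^n δ_s)`: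
`W_{n+1}(s) = [s ∈ box] Σ_z μ(z) W_n(s+z)`. [cite: Durrett2019, Theorem 2.5.5 (Markov property of the killed walk)] -/
theorem Λ_iterK_delta_succ (R n : ℕ) (s : ℤ) :
    Λ R (L.iterK R (n + 1) (delta s)) =
      if s ∈ box R then ∑ z ∈ L.S, L.μ z * Λ R (L.iterK R n (delta (s + z))) else 0 := by
  classical
  by_cases hs : s ∈ box R
  · rw [if_pos hs]
    unfold iterK
    rw [Function.iterate_succ_apply, stepK_delta]
    have hlin := L.iterK_finset_sum R L.S
      (fun z b => ((if s ∈ box R then 1 else 0) * (if s + z ∈ box R then 1 else 0) * L.μ z) * delta (s + z) b) n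
    unfold iterK at hlin
    rw [hlin]
    unfold Λ
    rw [Finset.sum_comm]
    refine Finset.sum_congr rfl fun z _ => ?_
    have hmul := L.iterK_const_mul' R (((if s ∈ box R then 1 else 0) * (if s + z ∈ box R then 1 else 0) * L.μ z))
      (delta (s + z)) n
    unfold iterK at hmul
    rw [hmul]
    simp only [if_pos hs, one_mul, ← Finset.mul_sum]
    by_cases hz : s + z ∈ box R
    · rw [if_pos hz, one_mul]
    · rw [if_neg hz, zero_mul, zero_mul]
      -- the walk started outside the box has no mass
      rcases Nat.eq_zero_or_pos n with rfl | hn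
      · simp only [Function.iterate_zero, id_eq]
        have := Λ_delta' R (s + z)
        unfold Λ at this
        rw [this, if_neg hz, mul_zero]
      · obtain ⟨m, rfl⟩ : ∃ m, n = m + 1 := ⟨n - 1, by omega⟩
        have := L.iterK_delta_of_not_mem hz m
        unfold iterK at this
        rw [this]
        simp
  · rw [if_neg hs]
    have := L.iterK_delta_of_not_mem hs n
    rw [this]
    simp [Λ]

/-- Non-negativity of `W_n(s)`. [cite: Durrett2019, Theorem 2.5.5] -/
theorem Λ_iterK_delta_nonneg (R : ℕ) : ∀ (n : ℕ) (s : ℤ), 0 ≤ Λ R (L.iterK R n (delta s)) := by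
  intro n
  induction n with
  | zero => intro s; unfold iterK; simp only [Function.iterate_zero, id_eq]; rw [Λ_delta']; split_ifs <;> norm_num
  | succ n ih =>
    intro s
    rw [Λ_iterK_delta_succ]
    split_ifs
    · exact Finset.sum_nonneg fun z _ => mul_nonneg (L.nonneg z) (ih _)
    · exact le_rfl

end Literature.Probability.Moments.KilledWalkTube.StepLaw

namespace Literature.Probability.RandomPlanarGeometry.SAW.Zd.StripDeficit

/-! ### Objects (verbatim from `Sketch_G10`) -/

open Classical in
/-- `N`-step bridges on `ℤ²` (from the origin, pulled direction `e₀`) confined to the transversal strip `|x₁| ≤ T`. [cite: MadrasSlade1993, §8.2 (bridges in a strip), Theorem 8.2.1] -/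
def stripBridges (T N : ℕ) : Finset (ℕ → Site 2) :=
  (bridges 2 N).filter fun ω => ∀ i ≤ N, |ω i 1| ≤ (T : ℤ)

/-- The pulled partition function of the strip: `Z^{strip}_{N,T}(y) = Σ_{ω ∈ stripBridges T N} y^{span ω}`. [cite: MadrasSlade1993, §8.2, Theorem 8.2.1; IoffeVelenik2008, §1 (pulled polymers)] -/
def pulledStripZ (T N : ℕ) (y : ℝ) : ℝ :=
  ∑ ω ∈ stripBridges T N, y ^ (ω N 0).toNat

/-- R51-U target: `limsup_N N⁻¹ log Z^{strip}_{N,T}(y) ≥ λ_B(y) − C/T²` for `T ≥ T₀`, in finite form. [cite: MadrasSlade1993, Theorem 8.2.1 (μ(strip_T) ↑ μ, no rate); DaoudDeGennes1977 (confinement prediction)] -/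
def StripDeficitUpper (y C : ℝ) (T₀ : ℕ) : Prop :=
  ∀ T : ℕ, T₀ ≤ T → ∀ ε : ℝ, 0 < ε →
    ∃ᶠ N : ℕ in atTop,
      Real.exp ((N : ℝ) * (pulledBridgeFreeEnergy 2 y - C / (T : ℝ) ^ 2 - ε)) ≤ pulledStripZ T N y

/-- R51-L target: `Z^{strip}_{N,T}(y) ≤ K_T · e^{N (λ_B(y) − c/T²)}` for all `N`, every `T ≥ 1`, ONE `c > 0`. [cite: MadrasSlade1993, Theorem 8.2.1; BrakOwczarekRechnitzerWhittington2005, §6 (directed T⁻² law)] -/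
def StripDeficitLower (y c : ℝ) : Prop :=
  ∀ T : ℕ, 1 ≤ T → ∃ K : ℝ, ∀ N : ℕ,
    pulledStripZ T N y ≤ K * Real.exp ((N : ℝ) * (pulledBridgeFreeEnergy 2 y - c / (T : ℝ) ^ 2))

/-- `Z^{strip}_{N,T}(y) ≥ 0`. [cite: MadrasSlade1993, §8.2 (walks and bridges in a strip)] -/
theorem pulledStripZ_nonneg (T N : ℕ) {y : ℝ} (hy : 0 ≤ y) : 0 ≤ pulledStripZ T N y :=
  sum_nonneg fun _ _ => pow_nonneg hy _

/-! ### S1 — the displacement-refined, length-tilted pulled block law as a `StepLaw` -/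

open Classical in
/-- `w^{θ}_I(z) = Σ_{i ≤ I} Σ_{π ∈ iSAB_i, π(i)₁ = z} y^{span π} e^{−i λ_B(y)} e^{θ i}`: the pulled block law refined by the
transversal displacement of the piece, tilted in the length, truncated at piece length `I`. [cite: IoffeVelenik2008, §3 (irreducible decomposition of ballistic polymers)] -/
def blockW (y θ : ℝ) (I : ℕ) (z : ℤ) : ℝ :=
  ∑ i ∈ range (I + 1), ∑ ω ∈ (irreducibleBridges 2 i).filter (fun ω => ω i 1 = z),
    y ^ (ω i 0).toNat * Real.exp (-(i : ℝ) * pulledBridgeFreeEnergy 2 y) * Real.exp (θ * i)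

/-- `w^{θ}_I(z) ≥ 0`. [cite: IoffeVelenik2008, §3 (irreducible decomposition of ballistic polymers)] -/
theorem blockW_nonneg {y : ℝ} (hy : 0 ≤ y) (θ : ℝ) (I : ℕ) (z : ℤ) : 0 ≤ blockW y θ I z :=
  sum_nonneg fun _ _ => sum_nonneg fun _ _ => by positivity


/-! #### a-p6 g3: proofs of S1a/S1b (helpers) -/

/-- The weight of a piece: `y^{span ω} e^{-i λ_B(y)} e^{θ i}`. [cite: Beaton2015, §3] -/
def pieceWeight (y θ : ℝ) (i : ℕ) (ω : ℕ → Site 2) : ℝ :=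
  y ^ (ω i 0).toNat * Real.exp (-(i : ℝ) * pulledBridgeFreeEnergy 2 y) * Real.exp (θ * i)

/-- Piece weights are non-negative. [cite: IoffeVelenik2008, §3] -/
theorem pieceWeight_nonneg {y : ℝ} (hy : 0 ≤ y) (θ : ℝ) (i : ℕ) (ω : ℕ → Site 2) : 0 ≤ pieceWeight y θ i ω := by
  unfold pieceWeight; positivity

/-- `blockW` in terms of `pieceWeight` (definitional). [cite: Beaton2015, §3] -/
theorem blockW_eq (y θ : ℝ) (I : ℕ) (z : ℤ) : blockW y θ I z =
    ∑ i ∈ range (I + 1), ∑ ω ∈ (irreducibleBridges 2 i).filter (fun ω => ω i 1 = z), pieceWeight y θ i ω := rfl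

/-- The total piece weight at length `i` is `p_i(y) e^{θ i}`. [cite: Beaton2015, §3, Lemma 2] -/
theorem sum_pieceWeight (y θ : ℝ) (i : ℕ) :
    ∑ ω ∈ irreducibleBridges 2 i, pieceWeight y θ i ω = pulledBlockLaw 2 y i * Real.exp (θ * i) := by
  rw [pulledBlockLaw, pulledIrrZ, Finset.sum_mul, Finset.sum_mul]
  rfl

/-- Reflection `x₁ ↦ -x₁` preserves irreducible bridges of `ℤ²` (a copy of the tree lemma of
`SAWRenewalMeasureSLLN`, kept local to avoid the measure-theory import). [cite: MadrasSlade1993, §8.2] -/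
private theorem reflectWalk_mem_irreducibleBridges₂ {n : ℕ} {ω : ℕ → Site 2}
    (hω : ω ∈ irreducibleBridges 2 n) : reflectWalk 1 ω ∈ irreducibleBridges 2 n := by
  obtain ⟨hb, h1, hbr, hirr⟩ := mem_irreducibleBridges.1 hω
  have h0 : ¬ 1 ≤ (0 : Fin 2).val := by simp
  have hc : ∀ i, reflectWalk 1 ω i 0 = ω i 0 := fun i => reflectWalk_apply_of_lt ω i h0
  refine mem_irreducibleBridges.2 ⟨reflectWalk_mem_bridges le_rfl hb, h1,
    hbr.congr fun i _ => (hc i).symm, fun k hk1 hk2 hren => hirr k hk1 hk2 ?_⟩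
  obtain ⟨hkn, hA, hB⟩ := hren
  refine ⟨hkn, fun i hi1 hi2 => ?_, fun i hi1 hi2 => ?_⟩
  · have := hA i hi1 hi2; simpa only [hc] using this
  · have := hB i hi1 hi2; simpa only [hc] using this

/-- The reflection negates the transversal displacement. [cite: MadrasSlade1993, §8.2] -/
theorem reflectWalk_apply_one (i : ℕ) (ω : ℕ → Site 2) : reflectWalk 1 ω i 1 = -ω i 1 :=
  reflectWalk_apply_of_le ω i (show 1 ≤ (1 : Fin 2).val by simp)

/-- The reflection keeps the piece weight (the span is a first-coordinate quantity). [cite: MadrasSlade1993, §8.2] -/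
theorem pieceWeight_reflectWalk (y θ : ℝ) (i : ℕ) (ω : ℕ → Site 2) :
    pieceWeight y θ i (reflectWalk 1 ω) = pieceWeight y θ i ω := by
  simp [pieceWeight, reflectWalk_apply_of_lt ω i (show ¬ 1 ≤ (0 : Fin 2).val by simp)]

/-- **Symmetry of the fibre sums**: total weight of the pieces with `ω(i)₁ = -z` equals that with `ω(i)₁ = z`.
[cite: MadrasSlade1993, §8.2] -/
theorem sum_filter_snd_neg (y θ : ℝ) (i : ℕ) (z : ℤ) :
    ∑ ω ∈ (irreducibleBridges 2 i).filter (fun ω => ω i 1 = -z), pieceWeight y θ i ω =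
      ∑ ω ∈ (irreducibleBridges 2 i).filter (fun ω => ω i 1 = z), pieceWeight y θ i ω := by
  classical
  refine Finset.sum_bij' (fun ω _ => reflectWalk 1 ω) (fun ω _ => reflectWalk 1 ω) ?_ ?_ ?_ ?_ ?_
  · intro ω hω
    rw [Finset.mem_filter] at hω ⊢
    exact ⟨reflectWalk_mem_irreducibleBridges₂ hω.1, by rw [reflectWalk_apply_one, hω.2, neg_neg]⟩
  · intro ω hω
    rw [Finset.mem_filter] at hω ⊢
    exact ⟨reflectWalk_mem_irreducibleBridges₂ hω.1, by rw [reflectWalk_apply_one, hω.2]⟩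
  · intro ω _; exact reflectWalk_reflectWalk 1 ω
  · intro ω _; exact reflectWalk_reflectWalk 1 ω
  · intro ω _; exact (pieceWeight_reflectWalk y θ i ω).symm

/-- `|ω(i)₁| ≤ i` for an `i`-step irreducible bridge. [cite: MadrasSlade1993, §1.1] -/
theorem abs_apply_one_le {i : ℕ} {ω : ℕ → Site 2} (hω : ω ∈ irreducibleBridges 2 i) : |ω i 1| ≤ (i : ℤ) := by
  have hs := (mem_bridges.1 (irreducibleBridges_subset_bridges i hω)).1
  exact abs_apply_le_of_adj (mem_saws.1 hs).1 (mem_saws.1 hs).2.2.1 i le_rfl 1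

/-- **S1a (stub)**: symmetry under the reflection `x₁ ↦ −x₁` (a bijection of `irreducibleBridges 2 i` preserving length
and span and negating the transversal displacement; tree `Zd.reflAt`). [cite: IoffeVelenik2008, §3; MadrasSlade1993, §1.2 (lattice symmetries)] -/
theorem stub_blockW_symm (y θ : ℝ) (I : ℕ) (z : ℤ) : blockW y θ I (-z) = blockW y θ I z := by
  rw [blockW_eq, blockW_eq]
  exact Finset.sum_congr rfl fun i _ => sum_filter_snd_neg y θ i z

/-- **S1b (stub)**: an `i`-step walk from the origin has `|ω(i)₁| ≤ i ≤ I` (tree `abs_apply_le_of_adj`). [cite: MadrasSlade1993, §1.1 (nearest-neighbour steps)] -/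
theorem stub_blockW_supp (y θ : ℝ) (I : ℕ) (z : ℤ) (hz : z ∉ Icc (-(I : ℤ)) I) : blockW y θ I z = 0 := by
  rw [blockW_eq]
  refine Finset.sum_eq_zero fun i hi => Finset.sum_eq_zero fun ω hω => ?_
  exfalso
  obtain ⟨hω, hz'⟩ := Finset.mem_filter.1 hω
  have h := abs_apply_one_le hω
  have hi' : (i : ℤ) ≤ I := by exact_mod_cast Nat.lt_succ_iff.1 (Finset.mem_range.1 hi)
  apply hz
  rw [mem_Icc, ← abs_le, ← hz']
  exact h.trans hi'

/-- the block step law `ν^{θ}_I` (kernel-form `StepLaw` of `KilledWalkTubeEstimates`) [cite: IoffeVelenik2008, §3 (the effective random walk of the irreducible pieces)] -/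
def blockLaw (y θ : ℝ) (hy : 0 ≤ y) (I : ℕ) : StepLaw where
  S := Icc (-(I : ℤ)) I
  μ := blockW y θ I
  nonneg := blockW_nonneg hy θ I
  symm := fun z => stub_blockW_symm y θ I z
  supp := fun z hz => stub_blockW_supp y θ I z hz
  negMem := fun z hz => by
    simp only [mem_Icc] at hz ⊢
    omega

/-! ### S2 — moments of `ν^{θ}_I` against the tilted moments of the block-length law -/

/-- `P^{θ}_j(I) = Σ_{i ≤ I} i^j p_i(y) e^{θ i}` [cite: IoffeVelenik2008, §3] -/
def pmom (y θ : ℝ) (j I : ℕ) : ℝ :=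
  ∑ i ∈ range (I + 1), (i : ℝ) ^ j * pulledBlockLaw 2 y i * Real.exp (θ * i)


/-! #### a-p6 g3: proofs of S2a–S2d (helpers) -/

/-- A moment of `ν^{θ}_I` as a sum over pieces. [cite: Beaton2015, §3] -/
theorem blockLaw_moment_eq {y : ℝ} (hy : 0 ≤ y) (θ : ℝ) (I : ℕ) (e : ℕ) :
    ∑ z ∈ (blockLaw y θ hy I).S, (z : ℝ) ^ e * (blockLaw y θ hy I).μ z =
      ∑ i ∈ range (I + 1), ∑ ω ∈ irreducibleBridges 2 i, ((ω i 1 : ℤ) : ℝ) ^ e * pieceWeight y θ i ω := by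
  classical
  show ∑ z ∈ Icc (-(I : ℤ)) I, (z : ℝ) ^ e * blockW y θ I z = _
  simp only [blockW_eq, Finset.mul_sum]
  rw [Finset.sum_comm]
  refine Finset.sum_congr rfl fun i hi => ?_
  have hi' : (i : ℤ) ≤ I := by exact_mod_cast Nat.lt_succ_iff.1 (Finset.mem_range.1 hi)
  have step : ∀ z ∈ Icc (-(I : ℤ)) I,
      ∑ ω ∈ (irreducibleBridges 2 i).filter (fun ω => ω i 1 = z), (z : ℝ) ^ e * pieceWeight y θ i ω =
        ∑ ω ∈ (irreducibleBridges 2 i).filter (fun ω => ω i 1 = z), ((ω i 1 : ℤ) : ℝ) ^ e * pieceWeight y θ i ω :=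
    fun z _ => Finset.sum_congr rfl fun ω hω => by rw [(Finset.mem_filter.1 hω).2]
  rw [Finset.sum_congr rfl step, Finset.sum_fiberwise_eq_sum_filter, Finset.filter_true_of_mem fun ω hω => ?_]
  rw [mem_Icc, ← abs_le]
  exact (abs_apply_one_le hω).trans hi'

/-- Moment bound `Σ_z z^e ν(z) ≤ Σ_{i ≤ I} i^e p_i e^{θ i}` for even `e` (`|ω(i)₁| ≤ i`). [cite: Beaton2015, §3] -/
theorem blockLaw_moment_le {y : ℝ} (hy : 0 ≤ y) (θ : ℝ) (I : ℕ) (e : ℕ) (he : Even e) :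
    ∑ z ∈ (blockLaw y θ hy I).S, (z : ℝ) ^ e * (blockLaw y θ hy I).μ z ≤ pmom y θ e I := by
  rw [blockLaw_moment_eq hy θ I e, pmom]
  refine Finset.sum_le_sum fun i _ => ?_
  rw [mul_assoc, ← sum_pieceWeight, Finset.mul_sum]
  refine Finset.sum_le_sum fun ω hω => mul_le_mul_of_nonneg_right ?_ (pieceWeight_nonneg hy θ i ω)
  obtain ⟨k, rfl⟩ := he
  rw [← two_mul, pow_mul, pow_mul]
  refine pow_le_pow_left₀ (sq_nonneg _) ?_ k
  have h' : |((ω i 1 : ℤ) : ℝ)| ≤ (i : ℝ) := by exact_mod_cast abs_apply_one_le hω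
  calc ((ω i 1 : ℤ) : ℝ) ^ 2 = |((ω i 1 : ℤ) : ℝ)| ^ 2 := (sq_abs _).symm
    _ ≤ (i : ℝ) ^ 2 := pow_le_pow_left₀ (abs_nonneg _) h' 2

/-- The 2-step hook `e₀ e₁` is an irreducible bridge. [cite: MadrasSlade1993, §4.2] -/
theorem ellWalk_one_two_mem : ellWalk 1 2 ∈ irreducibleBridges 2 2 :=
  ellWalk_mem_irreducibleBridges (Or.inl rfl) (by norm_num)

/-- **S2a (stub)**: `mass(ν^{θ}_I) = Σ_{i ≤ I} p_i e^{θ i}` (sum over `z` of the fibres = sum over pieces). [cite: IoffeVelenik2008, §3] -/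
theorem stub_blockLaw_mass {y : ℝ} (hy : 0 ≤ y) (θ : ℝ) (I : ℕ) : (blockLaw y θ hy I).mass = pmom y θ 0 I := by
  have h := blockLaw_moment_eq hy θ I 0
  simp only [pow_zero, one_mul] at h
  rw [StepLaw.mass, h, pmom]
  refine Finset.sum_congr rfl fun i _ => ?_
  rw [sum_pieceWeight, pow_zero, one_mul]

/-- **S2b (stub)**: `σ²(ν^{θ}_I) ≤ Σ_{i ≤ I} i² p_i e^{θ i}` (`|π(i)₁| ≤ i`). [cite: IoffeVelenik2008, §3] -/
theorem stub_blockLaw_var_le {y : ℝ} (hy : 0 ≤ y) (θ : ℝ) (I : ℕ) : (blockLaw y θ hy I).var ≤ pmom y θ 2 I :=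
  blockLaw_moment_le hy θ I 2 (by decide)

/-- **S2c (stub)**: `m₄(ν^{θ}_I) ≤ Σ_{i ≤ I} i⁴ p_i e^{θ i}`. [cite: IoffeVelenik2008, §3] -/
theorem stub_blockLaw_m4_le {y : ℝ} (hy : 0 ≤ y) (θ : ℝ) (I : ℕ) : (blockLaw y θ hy I).m4 ≤ pmom y θ 4 I :=
  blockLaw_moment_le hy θ I 4 (by decide)

/-- **S2d (stub)**: `σ²(ν^{θ}_I) ≥ 2 y e^{−2λ_B(y)}` for `I ≥ 2`, `θ ≥ 0` — the 2-step irreducible bridges `e₀e₁`, `e₀(−e₁)`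
(displacement `±1`, span `1`). [cite: IoffeVelenik2008, §3] -/
theorem stub_blockLaw_var_ge {y : ℝ} (hy : 0 ≤ y) {θ : ℝ} (hθ : 0 ≤ θ) {I : ℕ} (hI : 2 ≤ I) :
    2 * y * Real.exp (-2 * pulledBridgeFreeEnergy 2 y) ≤ (blockLaw y θ hy I).var := by
  -- the hook `e₀ e₁`: displacement 1, span 1, weight ≥ y e^{-2λ_B}
  have hhook := ellWalk_one_two_mem
  have heta : ellWalk 1 2 2 1 = 1 := by
    rw [ellWalk_apply_snd 1 2 (show 1 ≤ 2 by norm_num), min_self]; norm_num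
  have hsp : (ellWalk 1 2 2 0).toNat = 1 := by rw [ellWalk_apply_fst 1 2 (show 1 ≤ 2 by norm_num)]; rfl
  have hw : y * Real.exp (-2 * pulledBridgeFreeEnergy 2 y) ≤ pieceWeight y θ 2 (ellWalk 1 2) := by
    rw [pieceWeight, hsp, pow_one]
    have h1 : (1 : ℝ) ≤ Real.exp (θ * (2 : ℕ)) := Real.one_le_exp (by positivity)
    have h2 : 0 ≤ y * Real.exp (-((2 : ℕ) : ℝ) * pulledBridgeFreeEnergy 2 y) := by positivity
    calc y * Real.exp (-2 * pulledBridgeFreeEnergy 2 y)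
        = y * Real.exp (-((2 : ℕ) : ℝ) * pulledBridgeFreeEnergy 2 y) * 1 := by norm_num
      _ ≤ y * Real.exp (-((2 : ℕ) : ℝ) * pulledBridgeFreeEnergy 2 y) * Real.exp (θ * (2 : ℕ)) :=
          mul_le_mul_of_nonneg_left h1 h2
  -- μ(1) ≥ that weight, μ(-1) = μ(1)
  have hμ1 : y * Real.exp (-2 * pulledBridgeFreeEnergy 2 y) ≤ (blockLaw y θ hy I).μ 1 := by
    show _ ≤ blockW y θ I 1
    rw [blockW_eq]
    have h2I : 2 ∈ range (I + 1) := Finset.mem_range.2 (by omega)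
    refine le_trans ?_ (Finset.single_le_sum (fun i _ => Finset.sum_nonneg fun ω _ =>
      pieceWeight_nonneg hy θ i ω) h2I)
    refine le_trans hw (Finset.single_le_sum (fun ω _ => pieceWeight_nonneg hy θ 2 ω) ?_)
    exact Finset.mem_filter.2 ⟨hhook, heta⟩
  have hμm1 : y * Real.exp (-2 * pulledBridgeFreeEnergy 2 y) ≤ (blockLaw y θ hy I).μ (-1) := by
    rw [(blockLaw y θ hy I).symm 1]; exact hμ1
  have hpair : ({1, -1} : Finset ℤ) ⊆ (blockLaw y θ hy I).S := by
    intro z hz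
    simp only [Finset.mem_insert, Finset.mem_singleton] at hz
    show z ∈ Icc (-(I : ℤ)) I
    rw [mem_Icc]
    rcases hz with rfl | rfl <;> omega
  calc 2 * y * Real.exp (-2 * pulledBridgeFreeEnergy 2 y)
      ≤ ((1 : ℤ) : ℝ) ^ 2 * (blockLaw y θ hy I).μ 1 + (((-1 : ℤ) : ℝ)) ^ 2 * (blockLaw y θ hy I).μ (-1) := by
        push_cast; nlinarith
    _ = ∑ z ∈ ({1, -1} : Finset ℤ), (z : ℝ) ^ 2 * (blockLaw y θ hy I).μ z := by
        rw [Finset.sum_pair (by norm_num)]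
    _ ≤ (blockLaw y θ hy I).var := Finset.sum_le_sum_of_subset_of_nonneg hpair fun z _ _ =>
        mul_nonneg (sq_nonneg _) ((blockLaw y θ hy I).nonneg z)

/-! ### S3 — the two factorisation inequalities -/


/-! #### a-p4 g4: proof of S3a (`stub_strip_le_tube`) -/

section S3a

open Literature.Probability.Moments.KilledWalkTube.StepLaw

/-- **The first-renewal bijection as a sum identity**: for `N ≥ 1`, summing over `N`-step bridges is summing over
(first irreducible piece of length `i ∈ [1, N]`, remaining `(N-i)`-step bridge). [cite: MadrasSlade1993, §4.2, eq. (4.2.2)] -/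
theorem sum_bridges_eq_sum_sigma {N : ℕ} (hN : 1 ≤ N) (F : (ℕ → Site 2) → ℝ) :
    ∑ ω ∈ bridges 2 N, F ω =
      ∑ p ∈ (Icc 1 N).sigma (fun i => irreducibleBridges 2 i ×ˢ bridges 2 (N - i)), F (concatWalk p.1 p.2.1 p.2.2) := by
  classical
  symm
  refine Finset.sum_nbij (fun p => concatWalk p.1 p.2.1 p.2.2) ?_ ?_ ?_ (fun _ _ => rfl)
  · rintro ⟨s, η, τ⟩ hp
    simp only [mem_sigma, mem_Icc, mem_product] at hp
    obtain ⟨⟨-, hsn⟩, hη, hτ⟩ := hp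
    exact concatWalk_mem_bridges hsn (irreducibleBridges_subset_bridges s hη) hτ
  · rintro ⟨s, η, τ⟩ hp ⟨s', η', τ'⟩ hp' h
    simp only [mem_coe, mem_sigma, mem_Icc, mem_product] at hp hp'
    obtain ⟨⟨hs1, hsn⟩, hη, hτ⟩ := hp
    obtain ⟨⟨hs1', hsn'⟩, hη', hτ'⟩ := hp'
    dsimp only at h
    have hren := isRenewalTime_concatWalk hsn (irreducibleBridges_subset_bridges s hη) hτ
    have hren' := isRenewalTime_concatWalk hsn' (irreducibleBridges_subset_bridges s' hη') hτ'
    obtain rfl : s = s' := by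
      by_contra hne
      rcases lt_or_gt_of_ne hne with hlt | hlt
      · rw [h] at hren
        exact not_isRenewalTime_concatWalk_of_lt hsn' hη' hs1 hlt hren
      · rw [← h] at hren'
        exact not_isRenewalTime_concatWalk_of_lt hsn hη hs1' hlt hren'
    obtain ⟨h1, h2⟩ := concatWalk_injective_pieces
      (mem_bridges.1 (irreducibleBridges_subset_bridges s hη)).1 (mem_bridges.1 hτ).1
      (mem_bridges.1 (irreducibleBridges_subset_bridges s hη')).1 (mem_bridges.1 hτ').1 h
    subst h1 h2
    rfl
  · intro ω hω
    rw [mem_coe] at hω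
    obtain ⟨s, hs1, hs, hmin⟩ := exists_first_renewalTime hN (mem_bridges.1 hω).2
    refine ⟨⟨s, fun i => ω (min i s), fun j => ω (s + j) - ω s⟩, ?_, concatWalk_head_tail ω⟩
    simp only [mem_coe, mem_sigma, mem_Icc, mem_product]
    exact ⟨⟨hs1, hs.1⟩, headWalk_mem_irreducibleBridges hω hs1 hs hmin, tailShift_mem_bridges hω hs⟩

/-- **Weights are multiplicative under gluing**: span and length add. [cite: Beaton2015, §3] -/
theorem pieceWeight_concatWalk {y θ : ℝ} {N i : ℕ} (hiN : i ≤ N) {η τ : ℕ → Site 2} (hη : η ∈ bridges 2 i)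
    (hτ : τ ∈ bridges 2 (N - i)) :
    pieceWeight y θ N (concatWalk i η τ) = pieceWeight y θ i η * pieceWeight y θ (N - i) τ := by
  have hτ0 : τ 0 = 0 := (mem_saws.1 (mem_bridges.1 hτ).1).1
  have hend : concatWalk i η τ N 0 = η i 0 + τ (N - i) 0 := by
    rw [show N = i + (N - i) by omega, concatWalk_apply_add _ _ hτ0, Pi.add_apply, show i + (N - i) - i = N - i by omega]
  have h1 : 0 ≤ η i 0 := bridge_last_nonneg hη
  have h2 : 0 ≤ τ (N - i) 0 := bridge_last_nonneg hτ
  unfold pieceWeight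
  rw [hend, Int.toNat_add h1 h2, pow_add]
  have hexp : Real.exp (-(N : ℝ) * pulledBridgeFreeEnergy 2 y) * Real.exp (θ * N) =
      (Real.exp (-(i : ℝ) * pulledBridgeFreeEnergy 2 y) * Real.exp (θ * i)) *
        (Real.exp (-((N - i : ℕ) : ℝ) * pulledBridgeFreeEnergy 2 y) * Real.exp (θ * ((N - i : ℕ) : ℝ))) := by
    rw [← Real.exp_add, ← Real.exp_add, ← Real.exp_add, ← Real.exp_add]
    congr 1
    push_cast [Nat.cast_sub hiN]
    ring
  calc y ^ (η i 0).toNat * y ^ (τ (N - i) 0).toNat * Real.exp (-(N : ℝ) * pulledBridgeFreeEnergy 2 y) * Real.exp (θ * N)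
      = y ^ (η i 0).toNat * y ^ (τ (N - i) 0).toNat * (Real.exp (-(N : ℝ) * pulledBridgeFreeEnergy 2 y) * Real.exp (θ * N)) := by ring
    _ = _ := by rw [hexp]; ring

/-- The strip sum with a transversal offset `s`: `G_N(s) = Σ_{ω ∈ B_N} [∀ t, s + ω(t)₁ ∈ [-T,T]] · w(ω)`. (Local notation via a
`def`-free `abbrev` is avoided; the expression is spelled out.) [cite: MadrasSlade1993, §8.2 (bridges in a strip)] -/
theorem strip_offset_le_kernel {y : ℝ} (hy : 0 ≤ y) (θ : ℝ) (T I : ℕ) :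
    ∀ N, N ≤ I → ∀ s : ℤ,
      (∑ ω ∈ bridges 2 N, if ∀ t ≤ N, s + ω t 1 ∈ StepLaw.box T then pieceWeight y θ N ω else 0) ≤
        ∑ k ∈ range (N + 1), StepLaw.Λ T ((blockLaw y θ hy I).iterK T k (StepLaw.delta s)) := by
  classical
  set L := blockLaw y θ hy I with hL
  -- strong induction on `N`
  intro N
  induction N using Nat.strong_induction_on with
  | _ N ih =>
  intro hNI s
  have hW0 : ∀ k s, 0 ≤ StepLaw.Λ T (L.iterK T k (StepLaw.delta s)) := fun k s => Λ_iterK_delta_nonneg L T k s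
  rcases Nat.eq_zero_or_pos N with rfl | hNpos
  · -- `N = 0`: the only bridge is the trivial one
    rw [bridges_zero, Finset.sum_singleton, Finset.sum_range_one]
    unfold StepLaw.iterK
    simp only [Function.iterate_zero, id_eq, Λ_delta', Pi.zero_apply, add_zero, Nat.le_zero, forall_eq]
    unfold pieceWeight
    simp
  -- `N ≥ 1`: if `s ∉ box`, the left side vanishes (time `0`)
  by_cases hs : s ∈ StepLaw.box T
  swap
  · refine le_trans (le_of_eq (Finset.sum_eq_zero fun ω hω => ?_)) (Finset.sum_nonneg fun k _ => hW0 k s)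
    rw [if_neg]
    intro h
    have := h 0 (Nat.zero_le _)
    rw [(mem_saws.1 (mem_bridges.1 hω).1).1, Pi.zero_apply, add_zero] at this
    exact hs this
  -- split by the first renewal time
  rw [sum_bridges_eq_sum_sigma hNpos]
  -- termwise bound: `[strip_s(η ∘ τ)] w(η ∘ τ) ≤ w(η) · ([strip_{s + η(i)₁}(τ)] w(τ))`
  have hterm : ∀ p ∈ (Icc 1 N).sigma (fun i => irreducibleBridges 2 i ×ˢ bridges 2 (N - i)),
      (if ∀ t ≤ N, s + concatWalk p.1 p.2.1 p.2.2 t 1 ∈ StepLaw.box T then pieceWeight y θ N (concatWalk p.1 p.2.1 p.2.2) else 0) ≤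
        pieceWeight y θ p.1 p.2.1 *
          (if ∀ t ≤ N - p.1, (s + p.2.1 p.1 1) + p.2.2 t 1 ∈ StepLaw.box T then pieceWeight y θ (N - p.1) p.2.2 else 0) := by
    rintro ⟨i, η, τ⟩ hp
    simp only [mem_sigma, mem_Icc, mem_product] at hp
    obtain ⟨⟨hi1, hiN⟩, hη, hτ⟩ := hp
    dsimp only
    have hηb := irreducibleBridges_subset_bridges i hη
    have hτ0 : τ 0 = 0 := (mem_saws.1 (mem_bridges.1 hτ).1).1
    split_ifs with h1 h2
    · rw [pieceWeight_concatWalk hiN hηb hτ]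
    · exfalso; apply h2
      intro t ht
      have := h1 (i + t) (by omega)
      rwa [concatWalk_apply_add _ _ hτ0, Pi.add_apply, ← add_assoc] at this
    · exact mul_nonneg (pieceWeight_nonneg hy θ i η) (pieceWeight_nonneg hy θ _ τ)
    · rw [mul_zero]
  refine (Finset.sum_le_sum hterm).trans ?_
  rw [Finset.sum_sigma]
  -- inner sums: apply the induction hypothesis at `N - i < N`
  have hIH : ∀ i ∈ Icc 1 N, ∀ η ∈ irreducibleBridges 2 i,
      (∑ τ ∈ bridges 2 (N - i), if ∀ t ≤ N - i, (s + η i 1) + τ t 1 ∈ StepLaw.box T then pieceWeight y θ (N - i) τ else 0) ≤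
        ∑ k ∈ range N, StepLaw.Λ T (L.iterK T k (StepLaw.delta (s + η i 1))) := by
    intro i hi η _
    obtain ⟨hi1, hiN⟩ := mem_Icc.1 hi
    refine (ih (N - i) (by omega) (by omega) (s + η i 1)).trans ?_
    refine Finset.sum_le_sum_of_subset_of_nonneg (fun k hk => ?_) fun k _ _ => hW0 k _
    rw [mem_range] at hk ⊢; omega
  have hstep1 : ∑ i ∈ Icc 1 N, ∑ p ∈ irreducibleBridges 2 i ×ˢ bridges 2 (N - i),
      pieceWeight y θ i p.1 *
        (if ∀ t ≤ N - i, (s + p.1 i 1) + p.2 t 1 ∈ StepLaw.box T then pieceWeight y θ (N - i) p.2 else 0) ≤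
      ∑ i ∈ Icc 1 N, ∑ η ∈ irreducibleBridges 2 i,
        pieceWeight y θ i η * ∑ k ∈ range N, StepLaw.Λ T (L.iterK T k (StepLaw.delta (s + η i 1))) := by
    refine Finset.sum_le_sum fun i hi => ?_
    rw [Finset.sum_product]
    refine Finset.sum_le_sum fun η hη => ?_
    dsimp only
    rw [← Finset.mul_sum]
    exact mul_le_mul_of_nonneg_left (hIH i hi η hη) (pieceWeight_nonneg hy θ i η)
  refine hstep1.trans ?_
  -- regroup: extend `i ∈ Icc 1 N` to `range (I+1)`, swap sums, fibre over the displacement `η(i)₁ ∈ Icc (-I) I`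
  have hstep2 : ∑ i ∈ Icc 1 N, ∑ η ∈ irreducibleBridges 2 i,
      pieceWeight y θ i η * ∑ k ∈ range N, StepLaw.Λ T (L.iterK T k (StepLaw.delta (s + η i 1))) ≤
      ∑ k ∈ range N, ∑ z ∈ L.S, L.μ z * StepLaw.Λ T (L.iterK T k (StepLaw.delta (s + z))) := by
    calc ∑ i ∈ Icc 1 N, ∑ η ∈ irreducibleBridges 2 i,
          pieceWeight y θ i η * ∑ k ∈ range N, StepLaw.Λ T (L.iterK T k (StepLaw.delta (s + η i 1)))
        ≤ ∑ i ∈ range (I + 1), ∑ η ∈ irreducibleBridges 2 i,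
          pieceWeight y θ i η * ∑ k ∈ range N, StepLaw.Λ T (L.iterK T k (StepLaw.delta (s + η i 1))) := by
          refine Finset.sum_le_sum_of_subset_of_nonneg (fun i hi => ?_) fun i _ _ =>
            Finset.sum_nonneg fun η _ => mul_nonneg (pieceWeight_nonneg hy θ i η) (Finset.sum_nonneg fun k _ => hW0 k _)
          rw [mem_Icc] at hi; rw [mem_range]; omega
      _ = ∑ k ∈ range N, ∑ i ∈ range (I + 1), ∑ η ∈ irreducibleBridges 2 i,
          pieceWeight y θ i η * StepLaw.Λ T (L.iterK T k (StepLaw.delta (s + η i 1))) := by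
          rw [Finset.sum_comm]
          refine Finset.sum_congr rfl fun i _ => ?_
          rw [Finset.sum_comm]
          refine Finset.sum_congr rfl fun η _ => ?_
          rw [Finset.mul_sum]
      _ = ∑ k ∈ range N, ∑ z ∈ L.S, L.μ z * StepLaw.Λ T (L.iterK T k (StepLaw.delta (s + z))) := by
          refine Finset.sum_congr rfl fun k _ => ?_
          -- fibre over `z = η(i)₁`
          have hfib : ∀ i ∈ range (I + 1), ∑ η ∈ irreducibleBridges 2 i,
              pieceWeight y θ i η * StepLaw.Λ T (L.iterK T k (StepLaw.delta (s + η i 1))) =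
              ∑ z ∈ Icc (-(I : ℤ)) I, ∑ η ∈ (irreducibleBridges 2 i).filter (fun η => η i 1 = z),
                pieceWeight y θ i η * StepLaw.Λ T (L.iterK T k (StepLaw.delta (s + z))) := by
            intro i hi
            rw [← Finset.sum_fiberwise_of_maps_to (g := fun η : ℕ → Site 2 => η i 1) (t := Icc (-(I : ℤ)) I)]
            · refine Finset.sum_congr rfl fun z _ => Finset.sum_congr rfl fun η hη => ?_
              rw [(Finset.mem_filter.1 hη).2]
            · intro η hη
              have h := abs_apply_one_le hη
              have hi' : (i : ℤ) ≤ I := by exact_mod_cast Nat.lt_succ_iff.1 (Finset.mem_range.1 hi)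
              rw [mem_Icc, ← abs_le]
              exact h.trans hi'
          rw [Finset.sum_congr rfl hfib, Finset.sum_comm]
          refine Finset.sum_congr rfl fun z _ => ?_
          rw [show L.μ z = blockW y θ I z from rfl, blockW_eq, Finset.sum_mul]
          refine Finset.sum_congr rfl fun i _ => ?_
          rw [Finset.sum_mul]
  refine hstep2.trans ?_
  -- the backward recursion: `Σ_z μ(z) W_k(s+z) = W_{k+1}(s)` (as `s ∈ box`), then shift the range
  have hstep3 : ∑ k ∈ range N, ∑ z ∈ L.S, L.μ z * StepLaw.Λ T (L.iterK T k (StepLaw.delta (s + z))) =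
      ∑ k ∈ range N, StepLaw.Λ T (L.iterK T (k + 1) (StepLaw.delta s)) :=
    Finset.sum_congr rfl fun k _ => by rw [Λ_iterK_delta_succ, if_pos hs]
  rw [hstep3, Finset.sum_range_succ']
  linarith [hW0 0 s]

/-- **S3a**: every `N`-step strip bridge factorises into `k ≤ N` irreducible pieces of length `≤ N ≤ I` whose renewal
heights stay in `[−T, T]`: `x^N e^{θN} Z^{strip}_{N,T}(y) ≤ Σ_{k ≤ N} tubeMassK(ν^{θ}_I, k, T)`.
[cite: MadrasSlade1993, §4.2, eq. (4.2.2) and §8.2 (bridges in a strip); Beaton2015, §3] -/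
theorem strip_le_tube {y : ℝ} (hy : 0 ≤ y) {θ : ℝ} (hθ : 0 ≤ θ) (T N I : ℕ) (hNI : N ≤ I) :
    Real.exp (-(N : ℝ) * pulledBridgeFreeEnergy 2 y) * Real.exp (θ * N) * pulledStripZ T N y ≤
      ∑ k ∈ range (N + 1), (blockLaw y θ hy I).tubeMassK k T := by
  classical
  have _ := hθ
  have h := strip_offset_le_kernel hy θ T I N hNI 0
  have hl : Real.exp (-(N : ℝ) * pulledBridgeFreeEnergy 2 y) * Real.exp (θ * N) * pulledStripZ T N y =
      ∑ ω ∈ bridges 2 N, if ∀ t ≤ N, (0 : ℤ) + ω t 1 ∈ StepLaw.box T then pieceWeight y θ N ω else 0 := by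
    unfold pulledStripZ stripBridges
    rw [Finset.mul_sum, Finset.sum_filter]
    refine Finset.sum_congr rfl fun ω _ => ?_
    have hiff : (∀ i ≤ N, |ω i 1| ≤ (T : ℤ)) ↔ ∀ t ≤ N, (0 : ℤ) + ω t 1 ∈ StepLaw.box T := by
      simp only [zero_add, StepLaw.box, Finset.mem_Icc, abs_le]
    by_cases hc : ∀ i ≤ N, |ω i 1| ≤ (T : ℤ)
    · rw [if_pos hc, if_pos (hiff.1 hc)]; unfold pieceWeight; ring
    · rw [if_neg hc, if_neg (fun h => hc (hiff.2 h))]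
  rw [hl]
  exact h

end S3a

/-- **S3a (stub, for (L))**: every `N`-step strip bridge factorises uniquely into `k ≤ N` irreducible pieces of length
`≤ N ≤ I` whose renewal heights (the `x₁`-coordinates at the renewal times) stay in `[−T, T]`; with `x = e^{−λ_B}` and the
length tilt, `x^N e^{θN} Z^{strip}_{N,T}(y) ≤ Σ_{k ≤ N} tubeMassK(ν^{θ}_I, k, T)`. [cite: MadrasSlade1993, §4.2, eq. (4.2.2) and §8.2; IoffeVelenik2008, §3] -/
theorem stub_strip_le_tube {y : ℝ} (hy : 0 ≤ y) {θ : ℝ} (hθ : 0 ≤ θ) (T N I : ℕ) (hNI : N ≤ I) :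
    Real.exp (-(N : ℝ) * pulledBridgeFreeEnergy 2 y) * Real.exp (θ * N) * pulledStripZ T N y ≤
      ∑ k ∈ range (N + 1), (blockLaw y θ hy I).tubeMassK k T := by
  exact strip_le_tube hy hθ T N I hNI


/-! #### a-p4 g4: proof of S3b (`stub_tube_le_strip`) -/

section S3b

open Literature.Probability.Moments.KilledWalkTube.StepLaw

/-- `Λ_0 = ∅`: no irreducible bridge of length `0`. [cite: DuminilCopinHammond2013, §2.2] -/
theorem irreducibleBridges_two_zero : irreducibleBridges 2 0 = ∅ :=
  Finset.card_eq_zero.1 irreducibleBridgeCount_zero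

/-- **Gluing a short irreducible piece in front of a strip-confined bridge keeps it in the strip**: if `|s| ≤ R`, the piece
`η` has length `i ≤ I`, `R + I ≤ T`, and `τ` stays in the strip `[-T,T]` from the offset `s + η(i)₁`, then `η ∘ τ` stays in
`[-T,T]` from `s`. [cite: MadrasSlade1993, §8.2 (bridges in a strip)] -/
theorem strip_concat_of_piece {T I R i M : ℕ} (hIR : R + I ≤ T) (hiI : i ≤ I) (hiM : i ≤ M) {s : ℤ} (hs : s ∈ StepLaw.box R)
    {η τ : ℕ → Site 2} (hη : η ∈ bridges 2 i) (hτ : τ ∈ bridges 2 (M - i))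
    (hstrip : ∀ t ≤ M - i, (s + η i 1) + τ t 1 ∈ StepLaw.box T) :
    ∀ t ≤ M, s + concatWalk i η τ t 1 ∈ StepLaw.box T := by
  have hηs := (mem_bridges.1 hη).1
  obtain ⟨h0, -, hadj, -⟩ := mem_saws.1 hηs
  have hτ0 : τ 0 = 0 := (mem_saws.1 (mem_bridges.1 hτ).1).1
  simp only [StepLaw.box, Finset.mem_Icc] at hs hstrip ⊢
  intro t ht
  rcases le_or_gt t i with hti | hti
  · rw [concatWalk_apply_of_le _ _ hti]
    have hb := abs_le.1 (abs_apply_le_of_adj h0 hadj t hti 1)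
    constructor <;> omega
  · obtain ⟨u, rfl⟩ : ∃ u, t = i + u := ⟨t - i, by omega⟩
    rw [concatWalk_apply_add _ _ hτ0, Pi.add_apply, ← add_assoc]
    exact hstrip u (by omega)

/-- **The converse factorisation inequality, cumulative in the number of pieces** (the engine of S3b): for every offset `s`,
`Σ_{k<K} Λ_R(K^k δ_s) ≤ Σ_{N ≤ K I} G_N(s)`, where `G_N(s)` is the tilted weight of the `N`-step bridges confined to `[-T,T]`
from the offset `s`. [cite: MadrasSlade1993, §4.2, eq. (4.2.2) and §8.2; Beaton2015, §3] -/
theorem kernel_sum_le_strip_offset {y : ℝ} (hy : 0 ≤ y) (δ : ℝ) {T I R : ℕ} (hIR : R + I ≤ T) :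
    ∀ K (s : ℤ), ∑ k ∈ range K, StepLaw.Λ R ((blockLaw y δ hy I).iterK R k (StepLaw.delta s)) ≤
      ∑ N ∈ range (K * I + 1), ∑ ω ∈ bridges 2 N,
        if ∀ t ≤ N, s + ω t 1 ∈ StepLaw.box T then pieceWeight y δ N ω else 0 := by
  classical
  set L := blockLaw y δ hy I with hL
  -- the strip weights are non-negative
  have hG0 : ∀ N (s : ℤ), 0 ≤ ∑ ω ∈ bridges 2 N, (if ∀ t ≤ N, s + ω t 1 ∈ StepLaw.box T then pieceWeight y δ N ω else 0) :=
    fun N s => Finset.sum_nonneg fun ω _ => by split_ifs; exacts [pieceWeight_nonneg hy δ N ω, le_rfl]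
  have hW0 : ∀ k s, 0 ≤ StepLaw.Λ R (L.iterK R k (StepLaw.delta s)) := fun k s => Λ_iterK_delta_nonneg L R k s
  intro K
  induction K with
  | zero => intro s; simp only [Finset.range_zero, Finset.sum_empty]; exact Finset.sum_nonneg fun N _ => hG0 N s
  | succ K ih =>
    intro s
    -- `Σ_{k<K+1} W_k(s) = W_0(s) + Σ_{k<K} W_{k+1}(s)`
    rw [Finset.sum_range_succ']
    -- the zero-step term: `W_0(s) = [s ∈ box R] ≤ G_0(s) = [s ∈ box T]`
    have hzero : StepLaw.Λ R (L.iterK R 0 (StepLaw.delta s)) ≤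
        ∑ ω ∈ bridges 2 0, (if ∀ t ≤ 0, s + ω t 1 ∈ StepLaw.box T then pieceWeight y δ 0 ω else 0) := by
      unfold StepLaw.iterK
      simp only [Function.iterate_zero, id_eq, Λ_delta']
      rw [bridges_zero, Finset.sum_singleton]
      simp only [Nat.le_zero, forall_eq, Pi.zero_apply, add_zero]
      unfold pieceWeight
      simp only [Pi.zero_apply, Int.toNat_zero, pow_zero, Nat.cast_zero, neg_zero, zero_mul, mul_zero, Real.exp_zero, mul_one]
      split_ifs with h1 h2
      · exact le_rfl
      · exfalso; apply h2
        simp only [StepLaw.box, Finset.mem_Icc] at h1 ⊢; constructor <;> omega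
      · exact zero_le_one
      · exact le_rfl
    by_cases hs : s ∈ StepLaw.box R
    swap
    · -- from outside the box every `W_{k+1}(s)` vanishes
      have hvan : ∑ k ∈ range K, StepLaw.Λ R (L.iterK R (k + 1) (StepLaw.delta s)) = 0 :=
        Finset.sum_eq_zero fun k _ => by rw [Λ_iterK_delta_succ, if_neg hs]
      rw [hvan, zero_add]
      refine hzero.trans ?_
      rw [show (K + 1) * I + 1 = ((K + 1) * I) + 1 by ring, Finset.sum_range_succ']
      have : 0 ≤ ∑ N ∈ range ((K + 1) * I), ∑ ω ∈ bridges 2 (N + 1),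
          (if ∀ t ≤ N + 1, s + ω t 1 ∈ StepLaw.box T then pieceWeight y δ (N + 1) ω else 0) :=
        Finset.sum_nonneg fun N _ => hG0 (N + 1) s
      linarith
    -- the recursion and the induction hypothesis at the shifted offsets
    have hrec : ∑ k ∈ range K, StepLaw.Λ R (L.iterK R (k + 1) (StepLaw.delta s)) =
        ∑ z ∈ L.S, L.μ z * ∑ k ∈ range K, StepLaw.Λ R (L.iterK R k (StepLaw.delta (s + z))) := by
      rw [Finset.sum_congr rfl fun k _ => by rw [Λ_iterK_delta_succ, if_pos hs], Finset.sum_comm]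
      exact Finset.sum_congr rfl fun z _ => by rw [Finset.mul_sum]
    have hIH : ∑ z ∈ L.S, L.μ z * ∑ k ∈ range K, StepLaw.Λ R (L.iterK R k (StepLaw.delta (s + z))) ≤
        ∑ z ∈ L.S, L.μ z * ∑ N' ∈ range (K * I + 1), ∑ τ ∈ bridges 2 N',
          (if ∀ t ≤ N', (s + z) + τ t 1 ∈ StepLaw.box T then pieceWeight y δ N' τ else 0) :=
      Finset.sum_le_sum fun z _ => mul_le_mul_of_nonneg_left (ih (s + z)) (L.nonneg z)
    -- unfold `μ = blockW` as a sum over pieces and un-fibre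
    set Y : ℕ → ℕ → ℝ := fun i N' => ∑ η ∈ irreducibleBridges 2 i, pieceWeight y δ i η *
      ∑ τ ∈ bridges 2 N', (if ∀ t ≤ N', (s + η i 1) + τ t 1 ∈ StepLaw.box T then pieceWeight y δ N' τ else 0) with hY
    have hY0 : ∀ i N', 0 ≤ Y i N' := fun i N' =>
      Finset.sum_nonneg fun η _ => mul_nonneg (pieceWeight_nonneg hy δ i η) (hG0 N' _)
    have hunfib : ∑ z ∈ L.S, L.μ z * ∑ N' ∈ range (K * I + 1), ∑ τ ∈ bridges 2 N',
          (if ∀ t ≤ N', (s + z) + τ t 1 ∈ StepLaw.box T then pieceWeight y δ N' τ else 0) =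
        ∑ N' ∈ range (K * I + 1), ∑ i ∈ Icc 1 I, Y i N' := by
      -- `Σ_z μ(z) F(s+z) = Σ_{i ≤ I} Σ_{η ∈ Λ_i} w(η) F(s + η(i)₁)`
      have hF : ∀ F : ℤ → ℝ, ∑ z ∈ L.S, L.μ z * F (s + z) =
          ∑ i ∈ range (I + 1), ∑ η ∈ irreducibleBridges 2 i, pieceWeight y δ i η * F (s + η i 1) := by
        intro F
        have hfib : ∀ i ∈ range (I + 1), ∑ η ∈ irreducibleBridges 2 i, pieceWeight y δ i η * F (s + η i 1) =
            ∑ z ∈ Icc (-(I : ℤ)) I, ∑ η ∈ (irreducibleBridges 2 i).filter (fun η => η i 1 = z),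
              pieceWeight y δ i η * F (s + z) := by
          intro i hi
          rw [← Finset.sum_fiberwise_of_maps_to (g := fun η : ℕ → Site 2 => η i 1) (t := Icc (-(I : ℤ)) I)]
          · refine Finset.sum_congr rfl fun z _ => Finset.sum_congr rfl fun η hη => ?_
            rw [(Finset.mem_filter.1 hη).2]
          · intro η hη
            have h := abs_apply_one_le hη
            have hi' : (i : ℤ) ≤ I := by exact_mod_cast Nat.lt_succ_iff.1 (Finset.mem_range.1 hi)
            rw [mem_Icc, ← abs_le]
            exact h.trans hi'
        rw [Finset.sum_congr rfl hfib, Finset.sum_comm]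
        refine Finset.sum_congr rfl fun z _ => ?_
        rw [show L.μ z = blockW y δ I z from rfl, blockW_eq, Finset.sum_mul]
        refine Finset.sum_congr rfl fun i _ => ?_
        rw [Finset.sum_mul]
      rw [hF (fun u => ∑ N' ∈ range (K * I + 1), ∑ τ ∈ bridges 2 N',
        (if ∀ t ≤ N', u + τ t 1 ∈ StepLaw.box T then pieceWeight y δ N' τ else 0))]
      have hi : ∀ i ∈ range (I + 1), ∑ η ∈ irreducibleBridges 2 i, pieceWeight y δ i η *
          (∑ N' ∈ range (K * I + 1), ∑ τ ∈ bridges 2 N',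
            (if ∀ t ≤ N', (s + η i 1) + τ t 1 ∈ StepLaw.box T then pieceWeight y δ N' τ else 0)) =
          ∑ N' ∈ range (K * I + 1), Y i N' := by
        intro i _
        rw [hY]
        dsimp only
        simp_rw [Finset.mul_sum]
        rw [Finset.sum_comm]
      rw [Finset.sum_congr rfl hi, Finset.sum_comm]
      refine Finset.sum_congr rfl fun N' _ => ?_
      -- drop `i = 0` (no pieces): `range (I+1) = {0} ∪ Icc 1 I`
      rw [Finset.range_eq_Ico, show Finset.Ico 0 (I + 1) = insert 0 (Icc 1 I) by
        ext j; simp only [Finset.mem_Ico, Finset.mem_insert, Finset.mem_Icc]; omega,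
        Finset.sum_insert (by simp)]
      rw [show Y 0 N' = 0 by rw [hY]; dsimp only; rw [irreducibleBridges_two_zero, Finset.sum_empty], zero_add]
    -- reindex `(N', i) ↦ (M, i) = (N' + i, i)` and compare with the first-renewal decomposition of `G_M(s)`
    have hkey : ∀ M, 1 ≤ M → ∑ i ∈ Icc 1 M, (if i ≤ I then Y i (M - i) else 0) ≤
        ∑ ω ∈ bridges 2 M, (if ∀ t ≤ M, s + ω t 1 ∈ StepLaw.box T then pieceWeight y δ M ω else 0) := by
      intro M hM
      rw [sum_bridges_eq_sum_sigma hM, Finset.sum_sigma]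
      refine Finset.sum_le_sum fun i hi => ?_
      obtain ⟨hi1, hiM⟩ := Finset.mem_Icc.1 hi
      by_cases hiI : i ≤ I
      swap
      · rw [if_neg hiI]
        exact Finset.sum_nonneg fun p _ => by
          split_ifs; exacts [pieceWeight_nonneg hy δ M _, le_rfl]
      rw [if_pos hiI, hY]
      dsimp only
      rw [Finset.sum_product]
      refine Finset.sum_le_sum fun η hη => ?_
      rw [Finset.mul_sum]
      refine Finset.sum_le_sum fun τ hτ => ?_
      have hηb := irreducibleBridges_subset_bridges i hη
      split_ifs with h1 h2
      · rw [pieceWeight_concatWalk hiM hηb hτ]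
      · exact absurd (strip_concat_of_piece hIR hiI hiM hs hηb hτ h1) h2
      · rw [mul_zero]; exact pieceWeight_nonneg hy δ M _
      · rw [mul_zero]
    have hreidx : ∑ N' ∈ range (K * I + 1), ∑ i ∈ Icc 1 I, Y i N' ≤
        ∑ M ∈ Icc 1 ((K + 1) * I), ∑ i ∈ Icc 1 M, (if i ≤ I then Y i (M - i) else 0) := by
      rw [← Finset.sum_product']
      -- the injection `(N', i) ↦ ⟨N' + i, i⟩`
      have hinj : Set.InjOn (fun p : ℕ × ℕ => (⟨p.1 + p.2, p.2⟩ : Σ _ : ℕ, ℕ))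
          ↑(range (K * I + 1) ×ˢ Icc 1 I) := by
        rintro ⟨a, b⟩ _ ⟨a', b'⟩ _ h
        simp only [Sigma.mk.inj_iff, heq_eq_eq] at h
        obtain ⟨h1, rfl⟩ := h
        simp only [Prod.mk.injEq, and_true]
        omega
      calc ∑ p ∈ range (K * I + 1) ×ˢ Icc 1 I, Y p.2 p.1
          = ∑ q ∈ (range (K * I + 1) ×ˢ Icc 1 I).image (fun p : ℕ × ℕ => (⟨p.1 + p.2, p.2⟩ : Σ _ : ℕ, ℕ)),
              (if q.2 ≤ I then Y q.2 (q.1 - q.2) else 0) := by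
            rw [Finset.sum_image hinj]
            refine Finset.sum_congr rfl fun p hp => ?_
            obtain ⟨-, hb⟩ := Finset.mem_product.1 hp
            rw [if_pos (Finset.mem_Icc.1 hb).2, Nat.add_sub_cancel]
        _ ≤ ∑ q ∈ (Icc 1 ((K + 1) * I)).sigma (fun M => Icc 1 M), (if q.2 ≤ I then Y q.2 (q.1 - q.2) else 0) := by
            refine Finset.sum_le_sum_of_subset_of_nonneg (fun q hq => ?_) fun q _ _ => by
              split_ifs; exacts [hY0 _ _, le_rfl]
            obtain ⟨⟨a, b⟩, hp, rfl⟩ := Finset.mem_image.1 hq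
            obtain ⟨ha, hb⟩ := Finset.mem_product.1 hp
            rw [Finset.mem_range] at ha
            obtain ⟨hb1, hbI⟩ := Finset.mem_Icc.1 hb
            simp only [Finset.mem_sigma, Finset.mem_Icc]
            refine ⟨⟨by omega, ?_⟩, hb1, by omega⟩
            nlinarith
        _ = ∑ M ∈ Icc 1 ((K + 1) * I), ∑ i ∈ Icc 1 M, (if i ≤ I then Y i (M - i) else 0) := by
            rw [Finset.sum_sigma]
    -- assemble
    rw [add_comm]
    calc StepLaw.Λ R (L.iterK R 0 (StepLaw.delta s)) + ∑ k ∈ range K, StepLaw.Λ R (L.iterK R (k + 1) (StepLaw.delta s))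
        ≤ (∑ ω ∈ bridges 2 0, (if ∀ t ≤ 0, s + ω t 1 ∈ StepLaw.box T then pieceWeight y δ 0 ω else 0)) +
            ∑ M ∈ Icc 1 ((K + 1) * I), ∑ ω ∈ bridges 2 M,
              (if ∀ t ≤ M, s + ω t 1 ∈ StepLaw.box T then pieceWeight y δ M ω else 0) := by
          refine add_le_add hzero ?_
          rw [hrec]
          refine hIH.trans ?_
          rw [hunfib]
          refine hreidx.trans (Finset.sum_le_sum fun M hM => hkey M (Finset.mem_Icc.1 hM).1)
      _ = ∑ N ∈ range ((K + 1) * I + 1), ∑ ω ∈ bridges 2 N,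
            (if ∀ t ≤ N, s + ω t 1 ∈ StepLaw.box T then pieceWeight y δ N ω else 0) := by
          rw [Finset.range_eq_Ico, show Finset.Ico 0 ((K + 1) * I + 1) = insert 0 (Icc 1 ((K + 1) * I)) by
            ext j; simp only [Finset.mem_Ico, Finset.mem_insert, Finset.mem_Icc]; omega,
            Finset.sum_insert (by simp)]

/-- **S3b**: concatenations of `k < K` irreducible pieces of length `≤ I` whose renewal heights stay in `[−R, R]`, `R + I ≤ T`,
are distinct strip bridges of total length `≤ K·I`: `Σ_{k<K} tubeMassK(ν^{δ}_I, k, R) ≤ Σ_{N ≤ KI} x^N e^{δN} Z^{strip}_{N,T}(y)`.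
[cite: MadrasSlade1993, §4.2, eq. (4.2.2) and §8.2 (bridges in a strip); Beaton2015, §3] -/
theorem tube_le_strip {y : ℝ} (hy : 0 ≤ y) {δ : ℝ} (hδ : 0 ≤ δ) {T I R : ℕ} (hIR : R + I ≤ T) (K : ℕ) :
    ∑ k ∈ range K, (blockLaw y δ hy I).tubeMassK k R ≤
      ∑ N ∈ range (K * I + 1),
        Real.exp (-(N : ℝ) * pulledBridgeFreeEnergy 2 y) * Real.exp (δ * N) * pulledStripZ T N y := by
  classical
  have _ := hδ
  have h := kernel_sum_le_strip_offset hy δ hIR K 0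
  have hr : ∀ N : ℕ, Real.exp (-(N : ℝ) * pulledBridgeFreeEnergy 2 y) * Real.exp (δ * N) * pulledStripZ T N y =
      ∑ ω ∈ bridges 2 N, if ∀ t ≤ N, (0 : ℤ) + ω t 1 ∈ StepLaw.box T then pieceWeight y δ N ω else 0 := by
    intro N
    unfold pulledStripZ stripBridges
    rw [Finset.mul_sum, Finset.sum_filter]
    refine Finset.sum_congr rfl fun ω _ => ?_
    have hiff : (∀ i ≤ N, |ω i 1| ≤ (T : ℤ)) ↔ ∀ t ≤ N, (0 : ℤ) + ω t 1 ∈ StepLaw.box T := by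
      simp only [zero_add, StepLaw.box, Finset.mem_Icc, abs_le]
    by_cases hc : ∀ i ≤ N, |ω i 1| ≤ (T : ℤ)
    · rw [if_pos hc, if_pos (hiff.1 hc)]; unfold pieceWeight; ring
    · rw [if_neg hc, if_neg (fun h => hc (hiff.2 h))]
  rw [Finset.sum_congr rfl fun N _ => hr N]
  exact h

end S3b

/-- **S3b (stub, for (U))**: concatenations of `k < K` irreducible pieces of length `≤ I` whose renewal heights stay in
`[−R, R]`, `R + I ≤ T`, are DISTINCT strip bridges (a piece wanders at most its length from its starting height) of total
length `≤ K·I`; in tilted weights, `Σ_{k<K} tubeMassK(ν^{δ}_I, k, R) ≤ Σ_{N ≤ KI} x^N e^{δN} Z^{strip}_{N,T}(y)`. [cite: MadrasSlade1993, §4.2, eq. (4.2.2) and §8.2; IoffeVelenik2008, §3] -/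
theorem stub_tube_le_strip {y : ℝ} (hy : 0 ≤ y) {δ : ℝ} (hδ : 0 ≤ δ) {T I R : ℕ} (hIR : R + I ≤ T) (K : ℕ) :
    ∑ k ∈ range K, (blockLaw y δ hy I).tubeMassK k R ≤
      ∑ N ∈ range (K * I + 1),
        Real.exp (-(N : ℝ) * pulledBridgeFreeEnergy 2 y) * Real.exp (δ * N) * pulledStripZ T N y := by
  exact tube_le_strip hy hδ hIR K

/-! ### Analysis: the geometric envelope of the tilted moments (PROVED) -/

section Envelope

variable {y L : ℝ} (hy : 1 ≤ y) (hL : 0 < L) (hLB : Real.log L ≤ pulledBridgeFreeEnergy 2 y)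
  (hq : (2.688 : ℝ) ^ 3 * y < L ^ 3)

/-- the gap ratio `q` and the envelope amplitude `A` of `pulledBlockLaw_le_geometric` [cite: IoffeVelenik2008, §3 (exponential tails of the irreducible pieces)] -/
def gapQ (y L : ℝ) : ℝ := 2.688 * y ^ (1 / 3 : ℝ) / L
/-- The amplitude `A(y) = y^{2/3} + 2y` of the geometric envelope of the pulled block law. [cite: IoffeVelenik2008, §3 (exponential tails of the irreducible pieces)] -/
def gapA (y : ℝ) : ℝ := y ^ (2 / 3 : ℝ) + 2 * y

include hy hL in
/-- `q(y,L) > 0`. [cite: IoffeVelenik2008, §3] -/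
theorem gapQ_pos : 0 < gapQ y L :=
  lt_of_lt_of_le (inv_pos.2 hL) (inv_le_gapRatio hy hL)

include hy hL hq in
/-- `q(y,L) < 1` under the gap condition. [cite: IoffeVelenik2008, §3] -/
theorem gapQ_lt_one : gapQ y L < 1 := gapRatio_lt_one (by linarith) hL hq

include hy in
/-- `A(y) > 0`. [cite: IoffeVelenik2008, §3] -/
theorem gapA_pos : 0 < gapA y := by
  unfold gapA; positivity

/-- the tilt room `θ₀ = −log q / 2 > 0` and the tilted ratio `r = q e^{θ₀} = e^{log q / 2} < 1` [cite: IoffeVelenik2008, §3] -/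
def theta0 (y L : ℝ) : ℝ := -Real.log (gapQ y L) / 2
/-- `r = √q`, the envelope ratio after the length tilt `θ ≤ θ₀`. [cite: IoffeVelenik2008, §3] -/
def gapR (y L : ℝ) : ℝ := Real.exp (Real.log (gapQ y L) / 2)

include hy hL hq in
/-- `θ₀ > 0`. [cite: IoffeVelenik2008, §3] -/
theorem theta0_pos : 0 < theta0 y L := by
  have := Real.log_neg (gapQ_pos hy hL) (gapQ_lt_one hy hL hq)
  unfold theta0; linarith

include hy hL hq in
/-- `r < 1`. [cite: IoffeVelenik2008, §3] -/
theorem gapR_lt_one : gapR y L < 1 := by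
  have := Real.log_neg (gapQ_pos hy hL) (gapQ_lt_one hy hL hq)
  unfold gapR
  rw [← Real.exp_zero]
  exact Real.exp_lt_exp.2 (by linarith)

/-- `r > 0`. [cite: IoffeVelenik2008, §3] -/
theorem gapR_pos : 0 < gapR y L := Real.exp_pos _

include hy hL in
/-- `q e^{θ} ≤ r` for `θ ≤ θ₀` [cite: IoffeVelenik2008, §3] -/
theorem gapQ_mul_exp_le {θ : ℝ} (hθ : θ ≤ theta0 y L) : gapQ y L * Real.exp θ ≤ gapR y L := by
  have hq0 := gapQ_pos hy hL
  calc gapQ y L * Real.exp θ = Real.exp (Real.log (gapQ y L) + θ) := by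
        rw [Real.exp_add, Real.exp_log hq0]
    _ ≤ Real.exp (Real.log (gapQ y L) / 2) := Real.exp_le_exp.2 (by unfold theta0 at hθ; linarith)

/-- `S_j(r) = Σ_i i^j r^i` [cite: IoffeVelenik2008, §3] -/
def envS (y L : ℝ) (j : ℕ) : ℝ := ∑' i : ℕ, (i : ℝ) ^ j * gapR y L ^ i

include hy hL hq in
/-- The envelope moment series converge (`r < 1`). [cite: IoffeVelenik2008, §3] -/
theorem summable_envS (j : ℕ) : Summable fun i : ℕ => (i : ℝ) ^ j * gapR y L ^ i :=
  summable_pow_mul_geometric_of_norm_lt_one j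
    (by rw [Real.norm_eq_abs, abs_of_pos (gapR_pos (y := y) (L := L))]; exact gapR_lt_one hy hL hq)

/-- The envelope moments are non-negative. [cite: IoffeVelenik2008, §3] -/
theorem envS_nonneg (j : ℕ) : 0 ≤ envS y L j :=
  tsum_nonneg fun _ => mul_nonneg (pow_nonneg (Nat.cast_nonneg _) _) (pow_nonneg (gapR_pos).le _)

include hy hL hLB hq in
/-- **envelope of the tilted moments**: `P^{θ}_j(I) ≤ A · S_j(r)` for `0 ≤ θ ≤ θ₀`, every `I`. [cite: IoffeVelenik2008, §3] -/
theorem pmom_le_env {θ : ℝ} (hθ : θ ≤ theta0 y L) (j I : ℕ) :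
    pmom y θ j I ≤ gapA y * envS y L j := by
  have hA := (gapA_pos hy).le
  have hq0 := (gapQ_pos hy hL).le
  have hterm : ∀ i : ℕ, (i : ℝ) ^ j * pulledBlockLaw 2 y i * Real.exp (θ * i) ≤
      gapA y * ((i : ℝ) ^ j * gapR y L ^ i) := by
    intro i
    have hp : pulledBlockLaw 2 y i ≤ gapA y * gapQ y L ^ i := pulledBlockLaw_le_geometric hy hL hLB i
    have hp0 : 0 ≤ pulledBlockLaw 2 y i := pulledBlockLaw_nonneg (by linarith) i
    have he : Real.exp (θ * i) = Real.exp θ ^ i := by rw [← Real.exp_nat_mul]; ring_nf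
    have hqe : (gapQ y L * Real.exp θ) ^ i ≤ gapR y L ^ i :=
      pow_le_pow_left₀ (by positivity) (gapQ_mul_exp_le hy hL hθ) i
    calc (i : ℝ) ^ j * pulledBlockLaw 2 y i * Real.exp (θ * i)
        ≤ (i : ℝ) ^ j * (gapA y * gapQ y L ^ i) * Real.exp (θ * i) :=
          mul_le_mul_of_nonneg_right (mul_le_mul_of_nonneg_left hp (by positivity)) (Real.exp_pos _).le
      _ = gapA y * ((i : ℝ) ^ j * (gapQ y L * Real.exp θ) ^ i) := by rw [he, mul_pow]; ring
      _ ≤ gapA y * ((i : ℝ) ^ j * gapR y L ^ i) :=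
          mul_le_mul_of_nonneg_left (mul_le_mul_of_nonneg_left hqe (by positivity)) hA
  calc pmom y θ j I ≤ ∑ i ∈ range (I + 1), gapA y * ((i : ℝ) ^ j * gapR y L ^ i) := sum_le_sum fun i _ => hterm i
    _ = gapA y * ∑ i ∈ range (I + 1), (i : ℝ) ^ j * gapR y L ^ i := by rw [mul_sum]
    _ ≤ gapA y * envS y L j := by
        refine mul_le_mul_of_nonneg_left ?_ hA
        exact (summable_envS hy hL hq j).sum_le_tsum _ fun i _ =>
          mul_nonneg (pow_nonneg (Nat.cast_nonneg _) _) (pow_nonneg (gapR_pos).le _)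

/-- chord bound for the exponential tilt: `e^{θ x} ≤ 1 + (θ/θ₀) e^{θ₀ x}` for `0 ≤ θ ≤ θ₀`, `0 < θ₀`. [cite: IoffeVelenik2008, §3 (convexity of the exponential tilt)] -/
theorem exp_tilt_le_chord {θ θ₀ x : ℝ} (hθ0 : 0 ≤ θ) (hθ : θ ≤ θ₀) (hθ₀ : 0 < θ₀) :
    Real.exp (θ * x) ≤ 1 + θ / θ₀ * Real.exp (θ₀ * x) := by
  have hb0 : 0 ≤ θ / θ₀ := div_nonneg hθ0 hθ₀.le
  have hb1 : θ / θ₀ ≤ 1 := (div_le_one hθ₀).2 hθ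
  have h := convexOn_exp.2 (Set.mem_univ 0) (Set.mem_univ (θ₀ * x)) (by linarith : 0 ≤ 1 - θ / θ₀) hb0 (by ring)
  simp only [smul_eq_mul, mul_zero, zero_add, Real.exp_zero, mul_one] at h
  have e : θ / θ₀ * (θ₀ * x) = θ * x := by field_simp
  rw [e] at h
  calc Real.exp (θ * x) ≤ 1 - θ / θ₀ + θ / θ₀ * Real.exp (θ₀ * x) := h
    _ ≤ 1 + θ / θ₀ * Real.exp (θ₀ * x) := by linarith [mul_nonneg hb0 (Real.exp_pos (θ₀ * x)).le]

include hy hL hLB hq in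
/-- **mass upper bound**: `mass(ν^{θ}_I) ≤ 1 + C₁ θ`, `C₁ = A S₀(r)/θ₀`, for `0 ≤ θ ≤ θ₀`, every `I`. [cite: IoffeVelenik2008, §3] -/
theorem blockLaw_mass_le {θ : ℝ} (hθ0 : 0 ≤ θ) (hθ : θ ≤ theta0 y L) (I : ℕ) :
    (blockLaw y θ (by linarith) I).mass ≤ 1 + gapA y * envS y L 0 / theta0 y L * θ := by
  have hθ₀ := theta0_pos hy hL hq
  have hy0 : 0 < y := by linarith
  rw [stub_blockLaw_mass]
  have hterm : ∀ i : ℕ, (i : ℝ) ^ 0 * pulledBlockLaw 2 y i * Real.exp (θ * i) ≤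
      pulledBlockLaw 2 y i + θ / theta0 y L * ((i : ℝ) ^ 0 * pulledBlockLaw 2 y i * Real.exp (theta0 y L * i)) := by
    intro i
    have hp0 : 0 ≤ pulledBlockLaw 2 y i := pulledBlockLaw_nonneg hy0.le i
    have hc := exp_tilt_le_chord (x := (i : ℝ)) hθ0 hθ hθ₀
    simp only [pow_zero, one_mul]
    calc pulledBlockLaw 2 y i * Real.exp (θ * i) ≤ pulledBlockLaw 2 y i * (1 + θ / theta0 y L * Real.exp (theta0 y L * i)) :=
          mul_le_mul_of_nonneg_left hc hp0
      _ = pulledBlockLaw 2 y i + θ / theta0 y L * (pulledBlockLaw 2 y i * Real.exp (theta0 y L * i)) := by ring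
  have hsum1 : ∑ i ∈ range (I + 1), pulledBlockLaw 2 y i ≤ 1 := sum_range_pulledBlockLaw_le_one 1 hy0 (I + 1)
  have hP := pmom_le_env hy hL hLB hq le_rfl 0 I
  unfold pmom at hP ⊢
  calc ∑ i ∈ range (I + 1), (i : ℝ) ^ 0 * pulledBlockLaw 2 y i * Real.exp (θ * i)
      ≤ ∑ i ∈ range (I + 1), (pulledBlockLaw 2 y i +
          θ / theta0 y L * ((i : ℝ) ^ 0 * pulledBlockLaw 2 y i * Real.exp (theta0 y L * i))) :=
        sum_le_sum fun i _ => hterm i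
    _ = ∑ i ∈ range (I + 1), pulledBlockLaw 2 y i +
          θ / theta0 y L * ∑ i ∈ range (I + 1), (i : ℝ) ^ 0 * pulledBlockLaw 2 y i * Real.exp (theta0 y L * i) := by
        rw [sum_add_distrib, mul_sum]
    _ ≤ 1 + θ / theta0 y L * (gapA y * envS y L 0) :=
        add_le_add hsum1 (mul_le_mul_of_nonneg_left hP (div_nonneg hθ0 hθ₀.le))
    _ = 1 + gapA y * envS y L 0 / theta0 y L * θ := by
        field_simp

end Envelope

/-! ### Two `StepLaw` lemmas over the filed tube-estimate API (local copies)

Text (D) as filed (`Literature.Probability.Moments.KilledWalkTubeEstimates`, p329370) exposes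
`StepLaw.tube_upper` and `StepLaw.tubeMassK_nonneg` but not the two conveniences below (they are public only in
the unfiled v3 of that text); they are re-proved here from the filed API so that this file builds on the tree. -/

/-- positive variance forces positive mass (local copy of v3's `StepLaw.mass_pos_of_var_pos`). [folklore] -/
private theorem stepLaw_mass_pos_of_var_pos (L : StepLaw) (h : 0 < L.var) : 0 < L.mass := by
  by_contra hle
  rw [not_lt] at hle
  have hmass0 : L.mass = 0 := le_antisymm hle (Finset.sum_nonneg fun z _ => L.nonneg z)
  have hz : ∀ z ∈ L.S, L.μ z = 0 := fun z hz =>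
    (Finset.sum_eq_zero_iff_of_nonneg fun z _ => L.nonneg z).1 hmass0 z hz
  have : L.var = 0 := by
    unfold StepLaw.var
    exact Finset.sum_eq_zero fun z hz' => by rw [hz z hz', mul_zero]
  linarith

/-- partial sums of the tube generating function, explicit bound, under the hypotheses of `StepLaw.tube_upper`:
with `ρ := mass^{m+1}·(15/16) < 1`, `Σ_{k<n} tubeMassK k R ≤ (max 1 mass)^m · (m+1) · (1 − ρ)⁻¹`
(local copy of v3's `StepLaw.sum_range_tubeMassK_le`). [folklore] -/
private theorem stepLaw_sum_range_tubeMassK_le (L : StepLaw) (hmass : 0 < L.mass) (hvar : 0 < L.var) {R m : ℕ}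
    (hm₁ : 8 * (R : ℝ) ^ 2 * L.mass ≤ (m + 1 : ℕ) * L.var) (hm₂ : L.m4 * L.mass ≤ (m + 1 : ℕ) * L.var ^ 2)
    (hρ : L.mass ^ (m + 1) * (15 / 16) < 1) (n : ℕ) :
    ∑ k ∈ Finset.range n, L.tubeMassK k R ≤
      (max 1 L.mass) ^ m * (((m + 1 : ℕ) : ℝ) * (1 - L.mass ^ (m + 1) * (15 / 16))⁻¹) := by
  set ρ := L.mass ^ (m + 1) * (15 / 16) with hρdef
  have hρ0 : 0 ≤ ρ := by positivity
  set M := max 1 L.mass with hM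
  have hbd : ∀ k, L.tubeMassK k R ≤ M ^ m * ρ ^ (k / (m + 1)) := by
    intro k
    have h := StepLaw.tube_upper L hmass hvar hm₁ hm₂ k
    have hk : k = (m + 1) * (k / (m + 1)) + k % (m + 1) := (Nat.div_add_mod k (m + 1)).symm
    have hmk : L.mass ^ k = (L.mass ^ (m + 1)) ^ (k / (m + 1)) * L.mass ^ (k % (m + 1)) := by
      conv_lhs => rw [hk]
      rw [pow_add, pow_mul]
    have e : L.mass ^ k * ((15 : ℝ) / 16) ^ (k / (m + 1)) = ρ ^ (k / (m + 1)) * L.mass ^ (k % (m + 1)) := by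
      rw [hmk, hρdef, mul_pow]
      ring
    have hrest : L.mass ^ (k % (m + 1)) ≤ M ^ m :=
      calc L.mass ^ (k % (m + 1)) ≤ M ^ (k % (m + 1)) := pow_le_pow_left₀ hmass.le (le_max_right _ _) _
        _ ≤ M ^ m := pow_le_pow_right₀ (le_max_left _ _) (Nat.lt_succ_iff.1 (Nat.mod_lt _ (by omega)))
    calc L.tubeMassK k R ≤ L.mass ^ k * ((15 : ℝ) / 16) ^ (k / (m + 1)) := h
      _ = ρ ^ (k / (m + 1)) * L.mass ^ (k % (m + 1)) := e
      _ ≤ ρ ^ (k / (m + 1)) * M ^ m := mul_le_mul_of_nonneg_left hrest (pow_nonneg hρ0 _)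
      _ = M ^ m * ρ ^ (k / (m + 1)) := mul_comm _ _
  have h2 : ∀ n, ∑ i ∈ Finset.range ((m + 1) * n), ρ ^ (i / (m + 1)) =
      ((m + 1 : ℕ) : ℝ) * ∑ j ∈ Finset.range n, ρ ^ j := by
    intro n
    induction n with
    | zero => simp
    | succ n ih =>
      have hin : ∑ x ∈ Finset.range (m + 1), ρ ^ (((m + 1) * n + x) / (m + 1)) = ((m + 1 : ℕ) : ℝ) * ρ ^ n := by
        have : ∀ x ∈ Finset.range (m + 1), ρ ^ (((m + 1) * n + x) / (m + 1)) = ρ ^ n := by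
          intro x hx
          rw [Finset.mem_range] at hx
          congr 1
          rw [Nat.add_comm, Nat.add_mul_div_left _ _ (by omega : 0 < m + 1), Nat.div_eq_of_lt hx, zero_add]
        rw [Finset.sum_congr rfl this, Finset.sum_const, Finset.card_range, nsmul_eq_mul]
      rw [Nat.mul_succ, Finset.sum_range_add, ih, hin, Finset.sum_range_succ, mul_add]
  have hgeom : ∑ i ∈ Finset.range n, ρ ^ (i / (m + 1)) ≤ ((m + 1 : ℕ) : ℝ) * (1 - ρ)⁻¹ := by
    have h1 : ∑ i ∈ Finset.range n, ρ ^ (i / (m + 1)) ≤ ∑ i ∈ Finset.range ((m + 1) * n), ρ ^ (i / (m + 1)) :=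
      Finset.sum_le_sum_of_subset_of_nonneg (Finset.range_mono (Nat.le_mul_of_pos_left n (Nat.succ_pos m)))
        (fun i _ _ => pow_nonneg hρ0 _)
    have h3 : ∑ j ∈ Finset.range n, ρ ^ j ≤ (1 - ρ)⁻¹ := by
      have key : (∑ j ∈ Finset.range n, ρ ^ j) * (1 - ρ) ≤ 1 := by
        rw [geom_sum_mul_neg]
        linarith [pow_nonneg hρ0 n]
      rw [inv_eq_one_div, le_div_iff₀ (by linarith)]
      exact key
    calc ∑ i ∈ Finset.range n, ρ ^ (i / (m + 1))
        ≤ ∑ i ∈ Finset.range ((m + 1) * n), ρ ^ (i / (m + 1)) := h1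
      _ = ((m + 1 : ℕ) : ℝ) * ∑ j ∈ Finset.range n, ρ ^ j := h2 n
      _ ≤ ((m + 1 : ℕ) : ℝ) * (1 - ρ)⁻¹ := mul_le_mul_of_nonneg_left h3 (by positivity)
  calc ∑ k ∈ Finset.range n, L.tubeMassK k R ≤ ∑ k ∈ Finset.range n, M ^ m * ρ ^ (k / (m + 1)) :=
        Finset.sum_le_sum fun k _ => hbd k
    _ = M ^ m * ∑ k ∈ Finset.range n, ρ ^ (k / (m + 1)) := by rw [Finset.mul_sum]
    _ ≤ M ^ m * (((m + 1 : ℕ) : ℝ) * (1 - ρ)⁻¹) :=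
        mul_le_mul_of_nonneg_left hgeom (pow_nonneg (le_trans zero_le_one (le_max_left _ _)) _)

/-! ### (L) — the strip deficit is at least `c/T²` (PROVED from S1–S3 and the local `stepLaw_sum_range_tubeMassK_le`) -/

section Lower

/-- arithmetic of the block parameters for (L): the two moment hypotheses of `tube_upper` [cite: BrakOwczarekRechnitzerWhittington2005, §6 (the T⁻² confinement law, directed case); Durrett2019, Exercise 1.6.6] -/
theorem lower_params {mass var m4 σ2 Bb V₄ T : ℝ} {m : ℕ}
    (hmass : 0 < mass) (hmassB : mass ≤ Bb) (hσ2 : 0 < σ2) (hvarL : σ2 ≤ var)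
    (hm4 : m4 ≤ V₄) (hV₄ : 0 ≤ V₄)
    (hm_ge : 8 * T ^ 2 * Bb / σ2 + V₄ * Bb / σ2 ^ 2 ≤ m) :
    8 * T ^ 2 * mass ≤ ((m + 1 : ℕ) : ℝ) * var ∧ m4 * mass ≤ ((m + 1 : ℕ) : ℝ) * var ^ 2 := by
  have hBb : 0 < Bb := lt_of_lt_of_le hmass hmassB
  have hA : 0 ≤ 8 * T ^ 2 * Bb / σ2 := by positivity
  have hB : 0 ≤ V₄ * Bb / σ2 ^ 2 := by positivity
  have hm1 : ((m + 1 : ℕ) : ℝ) = (m : ℝ) + 1 := by push_cast; ring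
  constructor
  · have h1 : 8 * T ^ 2 * mass ≤ 8 * T ^ 2 * Bb := mul_le_mul_of_nonneg_left hmassB (by positivity)
    have h2 : 8 * T ^ 2 * Bb ≤ (m : ℝ) * σ2 := by
      have : 8 * T ^ 2 * Bb / σ2 ≤ m := le_trans (by linarith) hm_ge
      rwa [div_le_iff₀ hσ2] at this
    have h3 : (m : ℝ) * σ2 ≤ ((m : ℝ) + 1) * var := by nlinarith
    rw [hm1]
    linarith
  · have h1 : m4 * mass ≤ V₄ * Bb := mul_le_mul hm4 hmassB hmass.le hV₄
    have h2 : V₄ * Bb ≤ (m : ℝ) * σ2 ^ 2 := by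
      have : V₄ * Bb / σ2 ^ 2 ≤ m := le_trans (by linarith) hm_ge
      rwa [div_le_iff₀ (by positivity)] at this
    have h3 : (m : ℝ) * σ2 ^ 2 ≤ ((m : ℝ) + 1) * var ^ 2 := by
      have : σ2 ^ 2 ≤ var ^ 2 := pow_le_pow_left₀ hσ2.le hvarL 2
      nlinarith
    rw [hm1]
    linarith

/-- arithmetic for (L): the geometric ratio of `tube_upper` stays below `e^{1/32}·15/16 < 1` [cite: BrakOwczarekRechnitzerWhittington2005, §6] -/
theorem lower_ratio {mass a : ℝ} {m : ℕ} (hmass : 0 < mass) (hmassU : mass ≤ 1 + a) (ha : 0 ≤ a)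
    (hsmall : a * ((m + 1 : ℕ) : ℝ) ≤ 1 / 32) :
    mass ^ (m + 1) * (15 / 16) ≤ Real.exp (1 / 32) * (15 / 16) := by
  have h1 : mass ^ (m + 1) ≤ (1 + a) ^ (m + 1) := pow_le_pow_left₀ hmass.le hmassU _
  have h2 : (1 + a) ^ (m + 1) ≤ Real.exp a ^ (m + 1) :=
    pow_le_pow_left₀ (by positivity) (by linarith [Real.add_one_le_exp a]) _
  have h3 : Real.exp a ^ (m + 1) = Real.exp (a * ((m + 1 : ℕ) : ℝ)) := by
    rw [← Real.exp_nat_mul]; ring_nf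
  have h4 : Real.exp (a * ((m + 1 : ℕ) : ℝ)) ≤ Real.exp (1 / 32) := Real.exp_le_exp.2 hsmall
  exact mul_le_mul_of_nonneg_right (h1.trans (h2.trans (h3.le.trans h4))) (by norm_num)

/-- `e^{1/32} · 15/16 < 1`. [folklore] -/
private theorem exp_one_div_32_mul_lt_one : Real.exp (1 / 32) * (15 / 16) < 1 := by
  have h := Real.abs_exp_sub_one_sub_id_le (show |(1 : ℝ) / 32| ≤ 1 by norm_num)
  have h' : Real.exp (1 / 32) ≤ 1 + 1 / 32 + (1 / 32) ^ 2 := by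
    have := (abs_le.1 h).2; linarith
  nlinarith [h', Real.exp_pos (1 / 32 : ℝ)]

/-- arithmetic for (L): the constant of `stepLaw_sum_range_tubeMassK_le` is uniform in `N` [cite: BrakOwczarekRechnitzerWhittington2005, §6] -/
theorem lower_const {mass Bb ρ ρb : ℝ} {m : ℕ} (hBb1 : 1 ≤ Bb) (hmassB : mass ≤ Bb)
    (hρ : ρ ≤ ρb) (hρb : ρb < 1) :
    (max 1 mass) ^ m * (((m + 1 : ℕ) : ℝ) * (1 - ρ)⁻¹) ≤ Bb ^ m * (((m + 1 : ℕ) : ℝ) * (1 - ρb)⁻¹) := by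
  have hMB : max 1 mass ≤ Bb := max_le hBb1 hmassB
  have hpos1 : 0 < 1 - ρ := by linarith
  refine mul_le_mul (pow_le_pow_left₀ (le_trans zero_le_one (le_max_left _ _)) hMB m) ?_
    (mul_nonneg (Nat.cast_nonneg _) (inv_nonneg.2 hpos1.le)) (pow_nonneg (by linarith) m)
  exact mul_le_mul_of_nonneg_left (inv_anti₀ (by linarith) (by linarith)) (Nat.cast_nonneg _)

variable {y L : ℝ} (hy : 1 ≤ y) (hL : 0 < L) (hLB : Real.log L ≤ pulledBridgeFreeEnergy 2 y)
  (hq : (2.688 : ℝ) ^ 3 * y < L ^ 3)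

include hy hL hLB hq in
/-- **R51-L under the gap condition.** `∃ c > 0, ∀ T ≥ 1, ∃ K_T, ∀ N, Z^{strip}_{N,T}(y) ≤ K_T e^{N(λ_B(y) − c/T²)}`. [cite: MadrasSlade1993, Theorem 8.2.1 (no rate in print); BrakOwczarekRechnitzerWhittington2005, §6 (directed T⁻² law); DaoudDeGennes1977 (prediction) — quantitative form, this file] -/
theorem stripDeficitLower_of_gap : ∃ c : ℝ, 0 < c ∧ StripDeficitLower y c := by
  have hy0 : 0 < y := by linarith
  have hθ₀ := theta0_pos hy hL hq
  set lam := pulledBridgeFreeEnergy 2 y with hlam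
  set σ2 : ℝ := 2 * y * Real.exp (-2 * lam) with hσ2def
  have hσ2 : 0 < σ2 := by positivity
  set C₁ : ℝ := gapA y * envS y L 0 / theta0 y L with hC₁
  have hC₁ : 0 ≤ C₁ := div_nonneg (mul_nonneg (gapA_pos hy).le (envS_nonneg 0)) hθ₀.le
  set Bb : ℝ := 1 + C₁ * theta0 y L with hBb
  have hBb1 : 1 ≤ Bb := by have := mul_nonneg hC₁ hθ₀.le; linarith
  set V₄ : ℝ := gapA y * envS y L 4 with hV₄
  have hV₄ : 0 ≤ V₄ := mul_nonneg (gapA_pos hy).le (envS_nonneg 4)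
  set C₂ : ℝ := 8 * Bb / σ2 + V₄ * Bb / σ2 ^ 2 + 2 with hC₂
  have hC₂2 : 2 ≤ C₂ := by
    have : 0 ≤ 8 * Bb / σ2 + V₄ * Bb / σ2 ^ 2 := by positivity
    linarith
  set c : ℝ := min (theta0 y L) (1 / (32 * (C₁ + 1) * C₂)) with hc
  have hc0 : 0 < c := lt_min hθ₀ (by positivity)
  refine ⟨c, hc0, ?_⟩
  intro T hT
  have hT1 : (1 : ℝ) ≤ T := by exact_mod_cast hT
  have hT2 : (1 : ℝ) ≤ (T : ℝ) ^ 2 := by nlinarith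
  set θ : ℝ := c / (T : ℝ) ^ 2 with hθdef
  have hθ0 : 0 ≤ θ := by positivity
  have hθc : θ ≤ c := div_le_self hc0.le hT2
  have hθθ₀ : θ ≤ theta0 y L := hθc.trans (min_le_left _ _)
  set X : ℝ := 8 * (T : ℝ) ^ 2 * Bb / σ2 + V₄ * Bb / σ2 ^ 2 with hX
  have hX0 : 0 ≤ X := by positivity
  set m : ℕ := ⌈X⌉₊ with hmdef
  have hm_ge : X ≤ m := Nat.le_ceil _
  have hm_lt : (m : ℝ) < X + 1 := Nat.ceil_lt_add_one hX0
  have hm_le : ((m + 1 : ℕ) : ℝ) ≤ C₂ * (T : ℝ) ^ 2 := by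
    push_cast
    have h1 : V₄ * Bb / σ2 ^ 2 + 2 ≤ (V₄ * Bb / σ2 ^ 2 + 2) * (T : ℝ) ^ 2 :=
      le_mul_of_one_le_right (by positivity) hT2
    have h2 : C₂ * (T : ℝ) ^ 2 = 8 * (T : ℝ) ^ 2 * Bb / σ2 + (V₄ * Bb / σ2 ^ 2 + 2) * (T : ℝ) ^ 2 := by
      rw [hC₂]; ring
    rw [h2]
    linarith
  have hsmall : C₁ * θ * ((m + 1 : ℕ) : ℝ) ≤ 1 / 32 := by
    have h1 : C₁ * θ * ((m + 1 : ℕ) : ℝ) ≤ C₁ * θ * (C₂ * (T : ℝ) ^ 2) :=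
      mul_le_mul_of_nonneg_left hm_le (by positivity)
    have h2 : C₁ * θ * (C₂ * (T : ℝ) ^ 2) = C₁ * C₂ * c := by
      rw [hθdef]; field_simp
    have h3 : c ≤ 1 / (32 * (C₁ + 1) * C₂) := min_le_right _ _
    have h4 : C₁ * C₂ * c ≤ C₁ * C₂ * (1 / (32 * (C₁ + 1) * C₂)) :=
      mul_le_mul_of_nonneg_left h3 (by positivity)
    have h5 : C₁ * C₂ * (1 / (32 * (C₁ + 1) * C₂)) = C₁ / (C₁ + 1) / 32 := by
      field_simp
    have h6 : C₁ / (C₁ + 1) ≤ 1 := by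
      rw [div_le_one (by positivity)]; linarith
    calc C₁ * θ * ((m + 1 : ℕ) : ℝ) ≤ C₁ * C₂ * c := by rw [← h2]; exact h1
      _ ≤ C₁ / (C₁ + 1) / 32 := by rw [← h5]; exact h4
      _ ≤ 1 / 32 := by linarith
  set ρb : ℝ := Real.exp (1 / 32) * (15 / 16) with hρb
  have hρb1 : ρb < 1 := exp_one_div_32_mul_lt_one
  set K : ℝ := Bb ^ m * (((m + 1 : ℕ) : ℝ) * (1 - ρb)⁻¹) with hK
  refine ⟨K, fun N => ?_⟩
  -- the block law with pieces of length ≤ N + 2, tilt θ = c/T²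
  have hmassU : (blockLaw y θ hy0.le (N + 2)).mass ≤ 1 + C₁ * θ := blockLaw_mass_le hy hL hLB hq hθ0 hθθ₀ (N + 2)
  have hvarL : σ2 ≤ (blockLaw y θ hy0.le (N + 2)).var := stub_blockLaw_var_ge hy0.le hθ0 (by omega : 2 ≤ N + 2)
  have hvar : 0 < (blockLaw y θ hy0.le (N + 2)).var := lt_of_lt_of_le hσ2 hvarL
  have hmass : 0 < (blockLaw y θ hy0.le (N + 2)).mass := stepLaw_mass_pos_of_var_pos _ hvar
  have hmassB : (blockLaw y θ hy0.le (N + 2)).mass ≤ Bb := by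
    have : C₁ * θ ≤ C₁ * theta0 y L := mul_le_mul_of_nonneg_left hθθ₀ hC₁
    rw [hBb]; linarith
  have hm4 : (blockLaw y θ hy0.le (N + 2)).m4 ≤ V₄ :=
    (stub_blockLaw_m4_le hy0.le θ (N + 2)).trans (pmom_le_env hy hL hLB hq hθθ₀ 4 (N + 2))
  obtain ⟨hm₁, hm₂⟩ := lower_params (T := (T : ℝ)) hmass hmassB hσ2 hvarL hm4 hV₄ hm_ge
  have hρν := lower_ratio (m := m) hmass hmassU (mul_nonneg hC₁ hθ0) hsmall
  have hρ : (blockLaw y θ hy0.le (N + 2)).mass ^ (m + 1) * (15 / 16) < 1 := lt_of_le_of_lt hρν hρb1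
  have hsum := stepLaw_sum_range_tubeMassK_le _ hmass hvar hm₁ hm₂ hρ (N + 1)
  have hS3 := stub_strip_le_tube hy0.le hθ0 T N (N + 2) (by omega)
  have hKbd := lower_const (m := m) hBb1 hmassB hρν hρb1
  have hexp : Real.exp (-(N : ℝ) * lam) * Real.exp (θ * N) * pulledStripZ T N y ≤ K :=
    (hS3.trans hsum).trans hKbd
  have hpos : 0 < Real.exp (-(N : ℝ) * lam) * Real.exp (θ * N) := mul_pos (Real.exp_pos _) (Real.exp_pos _)
  have key : pulledStripZ T N y ≤ K / (Real.exp (-(N : ℝ) * lam) * Real.exp (θ * N)) := by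
    rw [le_div_iff₀ hpos]
    linarith [hexp]
  have heq : K / (Real.exp (-(N : ℝ) * lam) * Real.exp (θ * N)) =
      K * Real.exp ((N : ℝ) * (lam - θ)) := by
    rw [← Real.exp_add, div_eq_mul_inv, ← Real.exp_neg]
    congr 1
    congr 1
    ring
  rw [heq] at key
  exact key

end Lower

/-! ### (U) — the strip deficit is at most `C/T²` (PROVED from S1–S3 and `StepLaw.not_summable_tubeMassK`) -/

section Upper

/-- arithmetic for (U): with `T ≤ 8R'`, `T² ≥ 6912 V`, `m = ⌊R'²/(54V)⌋`, `δ = 55296 V/T²`: `m δ/2 ≥ 4` and `m ≥ 1` [cite: Durrett2019, Theorem 2.5.5 (Kolmogorov's maximal inequality); BrakOwczarekRechnitzerWhittington2005, §7] -/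
theorem upper_m {V T R' δ : ℝ} {m : ℕ} (hV : 0 < V) (hT : 0 < T) (hR' : T ≤ 8 * R')
    (hTV : 6912 * V ≤ T ^ 2) (hm : R' ^ 2 / (54 * V) < (m : ℝ) + 1) (hδ : δ = 55296 * V / T ^ 2) :
    4 ≤ (m : ℝ) * (δ / 2) ∧ 1 ≤ m := by
  have hT0 : T ≠ 0 := hT.ne'
  have hV0 : V ≠ 0 := hV.ne'
  have h1 : T ^ 2 ≤ 64 * R' ^ 2 := by nlinarith
  have h2 : T ^ 2 / (3456 * V) ≤ R' ^ 2 / (54 * V) := by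
    rw [div_le_div_iff₀ (by positivity) (by positivity)]
    nlinarith
  have h3 : (2 : ℝ) ≤ T ^ 2 / (3456 * V) := by
    rw [le_div_iff₀ (by positivity)]; linarith
  have h4 : T ^ 2 / (6912 * V) ≤ m := by
    have h5 : T ^ 2 / (6912 * V) = T ^ 2 / (3456 * V) / 2 := by
      rw [div_div]; ring
    rw [h5]; linarith
  have h6 : (1 : ℝ) ≤ T ^ 2 / (6912 * V) := by
    rw [le_div_iff₀ (by positivity)]; linarith
  refine ⟨?_, by exact_mod_cast h6.trans h4⟩
  have hδ0 : 0 ≤ δ := by rw [hδ]; positivity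
  have h7 : T ^ 2 / (6912 * V) * (δ / 2) ≤ (m : ℝ) * (δ / 2) :=
    mul_le_mul_of_nonneg_right h4 (by positivity)
  have h8 : T ^ 2 / (6912 * V) * (δ / 2) = 4 := by
    rw [hδ]; field_simp; ring
  linarith

/-- analysis for (U): if the tube masses are dominated by partial sums of a sequence that is eventually
`≤ e^{−εN}`, they are summable [cite: IoffeVelenik2008, §3 (root test on the renewal series)] -/
theorem upper_contra {a t : ℕ → ℝ} {I : ℕ} {ε : ℝ} (hε : 0 < ε) (ha0 : ∀ N, 0 ≤ a N) (ht0 : ∀ k, 0 ≤ t k)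
    (hS3 : ∀ K, ∑ k ∈ range K, t k ≤ ∑ N ∈ range (K * I + 1), a N)
    (hev : ∀ᶠ N in atTop, a N ≤ Real.exp (-ε * N)) : Summable t := by
  have hg : Summable (fun N : ℕ => Real.exp (-ε * N)) := by
    have h : (fun N : ℕ => Real.exp (-ε * N)) = fun N : ℕ => Real.exp (-ε) ^ N := by
      funext N; rw [← Real.exp_nat_mul]; ring_nf
    rw [h]
    exact summable_geometric_of_lt_one (Real.exp_pos _).le (Real.exp_lt_one_iff.2 (by linarith))
  have hsa : Summable a := Summable.of_norm_bounded_eventually_nat hg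
    (hev.mono fun N h => by rw [Real.norm_eq_abs, abs_of_nonneg (ha0 N)]; exact h)
  refine summable_of_sum_range_le ht0 (c := ∑' N, a N) fun K => (hS3 K).trans ?_
  exact hsa.sum_le_tsum _ (fun N _ => ha0 N)

variable {y L : ℝ} (hy : 1 ≤ y) (hL : 0 < L) (hLB : Real.log L ≤ pulledBridgeFreeEnergy 2 y)
  (hq : (2.688 : ℝ) ^ 3 * y < L ^ 3)

include hy hL hLB hq in
/-- mass of the `δ`-tilted truncated block law: `≥ 1 + δ/2` once the geometric tail beyond `I` is `≤ δ/4`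
(`p_0 = 0`, `e^{δ i} ≥ 1 + δ` for `i ≥ 1`, `Σ p_i = 1`, `p_i ≤ A qⁱ`). [cite: IoffeVelenik2008, §3] -/
theorem blockLaw_mass_ge {δ : ℝ} (hδ0 : 0 ≤ δ) (hδ1 : δ ≤ 1) (I : ℕ)
    (htail : gapA y * gapQ y L ^ (I + 1) * (1 - gapQ y L)⁻¹ ≤ δ / 4) :
    1 + δ / 2 ≤ (blockLaw y δ (by linarith) I).mass := by
  have hy0 : 0 < y := by linarith
  have hq0 := gapQ_pos hy hL
  have hq1 := gapQ_lt_one hy hL hq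
  have hHas := hasSum_pulledBlockLaw hy hL hLB hq
  have hp0 : ∀ i, 0 ≤ pulledBlockLaw 2 y i := fun i => pulledBlockLaw_nonneg hy0.le i
  have hpq : ∀ i, pulledBlockLaw 2 y i ≤ gapA y * gapQ y L ^ i := fun i =>
    pulledBlockLaw_le_geometric hy hL hLB i
  have hsplit : ∑ i ∈ range (I + 1), pulledBlockLaw 2 y i + ∑' i, pulledBlockLaw 2 y (i + (I + 1)) = 1 := by
    rw [hHas.summable.sum_add_tsum_nat_add (I + 1), hHas.tsum_eq]
  have hg : Summable (fun i : ℕ => gapA y * gapQ y L ^ (I + 1) * gapQ y L ^ i) :=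
    (summable_geometric_of_lt_one hq0.le hq1).mul_left _
  have hpt : Summable (fun i => pulledBlockLaw 2 y (i + (I + 1))) :=
    (summable_nat_add_iff (I + 1)).2 hHas.summable
  have htail_le : ∑' i, pulledBlockLaw 2 y (i + (I + 1)) ≤
      gapA y * gapQ y L ^ (I + 1) * (1 - gapQ y L)⁻¹ := by
    calc ∑' i, pulledBlockLaw 2 y (i + (I + 1))
        ≤ ∑' i : ℕ, gapA y * gapQ y L ^ (I + 1) * gapQ y L ^ i :=
          hpt.tsum_le_tsum (fun i => (hpq _).trans_eq (by rw [pow_add]; ring)) hg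
      _ = gapA y * gapQ y L ^ (I + 1) * (1 - gapQ y L)⁻¹ := by
          rw [tsum_mul_left, tsum_geometric_of_lt_one hq0.le hq1]
  have hsum_ge : 1 - δ / 4 ≤ ∑ i ∈ range (I + 1), pulledBlockLaw 2 y i := by linarith
  have hpm : (1 + δ) * ∑ i ∈ range (I + 1), pulledBlockLaw 2 y i ≤ pmom y δ 0 I := by
    rw [pmom, Finset.mul_sum]
    refine Finset.sum_le_sum fun i _ => ?_
    rcases Nat.eq_zero_or_pos i with rfl | hi
    · simp [pulledBlockLaw_zero]
    · have h1 : 1 + δ ≤ Real.exp (δ * i) := by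
        have hi' : (1 : ℝ) ≤ i := by exact_mod_cast hi
        have hδi : δ ≤ δ * i := le_mul_of_one_le_right hδ0 hi'
        linarith [Real.add_one_le_exp (δ * i)]
      rw [pow_zero, one_mul]
      nlinarith [hp0 i, mul_nonneg (hp0 i) (sub_nonneg.2 h1)]
  rw [stub_blockLaw_mass]
  have h2 : (1 + δ) * (1 - δ / 4) ≤ (1 + δ) * ∑ i ∈ range (I + 1), pulledBlockLaw 2 y i :=
    mul_le_mul_of_nonneg_left hsum_ge (by linarith)
  nlinarith [h2, hpm, mul_nonneg hδ0 (sub_nonneg.2 hδ1)]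

include hy hL hLB hq in
/-- **R51-U under the gap condition.** `∃ C T₀, ∀ T ≥ T₀, ∀ ε > 0, ∃ᶠ N, e^{N(λ_B(y) − C/T² − ε)} ≤ Z^{strip}_{N,T}(y)`. [cite: MadrasSlade1993, Theorem 8.2.1 (no rate in print); BrakOwczarekRechnitzerWhittington2005, §7 (directed T⁻² law); DaoudDeGennes1977 (prediction) — quantitative form, this file] -/
theorem stripDeficitUpper_of_gap : ∃ C : ℝ, ∃ T₀ : ℕ, StripDeficitUpper y C T₀ := by
  have hy0 : 0 < y := by linarith
  have hθ₀ := theta0_pos hy hL hq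
  have hq0 := gapQ_pos hy hL
  have hq1 := gapQ_lt_one hy hL hq
  have hA := gapA_pos hy
  have hq1' : 0 < 1 - gapQ y L := by linarith
  set V : ℝ := gapA y * envS y L 2 + 1 with hV
  have hV0 : 0 < V := by
    have := mul_nonneg hA.le (envS_nonneg (y := y) (L := L) 2); linarith
  set C : ℝ := 55296 * V with hC
  have hC0 : 0 < C := by positivity
  set ε₁ : ℝ := C * (1 - gapQ y L) / (16 * gapA y) with hε₁
  have hε₁0 : 0 < ε₁ := by positivity
  have htend := tendsto_pow_const_mul_const_pow_of_abs_lt_one 2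
    (show |gapQ y L| < 1 by rw [abs_of_pos hq0]; exact hq1)
  obtain ⟨I₀, hI₀⟩ := Filter.eventually_atTop.1 ((tendsto_order.1 htend).2 ε₁ hε₁0)
  set T₀ : ℕ := ⌈6912 * V + C + C / theta0 y L⌉₊ + 2 * I₀ + 8 with hT₀
  refine ⟨C, T₀, ?_⟩
  intro T hT ε hε
  -- the geometric parameters
  set R' : ℕ := T / 4 with hR'
  set R : ℕ := 2 * R' with hR
  set I : ℕ := T - R with hI
  have hRR' : 2 * R' ≤ R := by omega
  have hR'0 : 0 < R' := by omega
  have hRI : R + I ≤ T := by omega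
  have hTI : T ≤ 2 * I := by omega
  have hTR' : T ≤ 8 * R' := by omega
  have hII₀ : I₀ ≤ I := by omega
  have hIpos : 0 < I := by omega
  -- real consequences of `T ≥ T₀`
  have hceil : (⌈6912 * V + C + C / theta0 y L⌉₊ : ℝ) ≤ T := by
    exact_mod_cast (show ⌈6912 * V + C + C / theta0 y L⌉₊ ≤ T by omega)
  have hX : 6912 * V + C + C / theta0 y L ≤ T := (Nat.le_ceil _).trans hceil
  have hT1 : (1 : ℝ) ≤ T := by exact_mod_cast (show 1 ≤ T by omega)
  have hTpos : (0 : ℝ) < T := by linarith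
  have hTsq : (T : ℝ) ≤ (T : ℝ) ^ 2 := by nlinarith
  have hCθ : 0 ≤ C / theta0 y L := by positivity
  have hTV : 6912 * V ≤ (T : ℝ) ^ 2 := by linarith
  have hTC : C ≤ (T : ℝ) ^ 2 := by linarith
  have hTCθ : C / theta0 y L ≤ (T : ℝ) ^ 2 := by linarith
  have hT2pos : 0 < (T : ℝ) ^ 2 := by positivity
  set δ : ℝ := C / (T : ℝ) ^ 2 with hδdef
  have hδ0 : 0 ≤ δ := by positivity
  have hδ1 : δ ≤ 1 := by rw [hδdef, div_le_one hT2pos]; exact hTC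
  have hδθ : δ ≤ theta0 y L := by
    rw [hδdef, div_le_iff₀ hT2pos]
    have := (div_le_iff₀ hθ₀).1 hTCθ
    linarith
  -- the geometric tail beyond `I` is `≤ δ/4`
  have htail : gapA y * gapQ y L ^ (I + 1) * (1 - gapQ y L)⁻¹ ≤ δ / 4 := by
    have h1 : ((I : ℕ) : ℝ) ^ 2 * gapQ y L ^ I < ε₁ := hI₀ I hII₀
    have hqI : gapQ y L ^ (I + 1) ≤ gapQ y L ^ I := pow_le_pow_of_le_one hq0.le hq1.le (Nat.le_succ I)
    have hTI' : (T : ℝ) ≤ 2 * I := by exact_mod_cast hTI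
    have hT2le : (T : ℝ) ^ 2 * 4 ≤ 16 * (I : ℝ) ^ 2 := by nlinarith
    have h2 : C / (16 * (I : ℝ) ^ 2) ≤ C / ((T : ℝ) ^ 2 * 4) :=
      div_le_div_of_nonneg_left hC0.le (by positivity) hT2le
    have h3 : gapA y * gapQ y L ^ I * (1 - gapQ y L)⁻¹ * (16 * (I : ℝ) ^ 2) ≤ C := by
      have h := mul_le_mul_of_nonneg_left h1.le
        (show 0 ≤ 16 * gapA y * (1 - gapQ y L)⁻¹ from mul_nonneg (by positivity) (inv_nonneg.2 hq1'.le))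
      have he : 16 * gapA y * (1 - gapQ y L)⁻¹ * ε₁ = C := by
        rw [hε₁]; field_simp
      calc gapA y * gapQ y L ^ I * (1 - gapQ y L)⁻¹ * (16 * (I : ℝ) ^ 2)
          = 16 * gapA y * (1 - gapQ y L)⁻¹ * (((I : ℕ) : ℝ) ^ 2 * gapQ y L ^ I) := by ring
        _ ≤ 16 * gapA y * (1 - gapQ y L)⁻¹ * ε₁ := h
        _ = C := he
    have hIsq : 0 < 16 * (I : ℝ) ^ 2 := by positivity
    calc gapA y * gapQ y L ^ (I + 1) * (1 - gapQ y L)⁻¹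
        ≤ gapA y * gapQ y L ^ I * (1 - gapQ y L)⁻¹ :=
          mul_le_mul_of_nonneg_right (mul_le_mul_of_nonneg_left hqI hA.le) (inv_nonneg.2 hq1'.le)
      _ ≤ C / (16 * (I : ℝ) ^ 2) := by rw [le_div_iff₀ hIsq]; exact h3
      _ ≤ C / ((T : ℝ) ^ 2 * 4) := h2
      _ = δ / 4 := by rw [hδdef, div_div]
  -- the law and its moments
  have hmass2 : 1 + δ / 2 ≤ (blockLaw y δ hy0.le I).mass := blockLaw_mass_ge hy hL hLB hq hδ0 hδ1 I htail
  have hmass1 : 1 ≤ (blockLaw y δ hy0.le I).mass := by linarith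
  have hvarV : (blockLaw y δ hy0.le I).var ≤ V :=
    (stub_blockLaw_var_le hy0.le δ I).trans ((pmom_le_env hy hL hLB hq hδθ 2 I).trans (by linarith))
  have hvar0 : 0 ≤ (blockLaw y δ hy0.le I).var := by
    unfold StepLaw.var
    exact sum_nonneg fun z _ => mul_nonneg (sq_nonneg _) ((blockLaw y δ hy0.le I).nonneg z)
  set m : ℕ := ⌊((R' : ℕ) : ℝ) ^ 2 / (54 * V)⌋₊ with hmdef
  have hm_le : (m : ℝ) ≤ ((R' : ℕ) : ℝ) ^ 2 / (54 * V) := Nat.floor_le (by positivity)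
  have hm_lt : ((R' : ℕ) : ℝ) ^ 2 / (54 * V) < (m : ℝ) + 1 := Nat.lt_floor_add_one _
  have hTR're : (T : ℝ) ≤ 8 * ((R' : ℕ) : ℝ) := by exact_mod_cast hTR'
  obtain ⟨hmδ, hm1⟩ := upper_m hV0 hTpos hTR're hTV hm_lt (show δ = 55296 * V / (T : ℝ) ^ 2 by rw [hδdef])
  have hm54 : 54 * (m : ℝ) * V ≤ ((R' : ℕ) : ℝ) ^ 2 := by
    have := (le_div_iff₀ (by positivity : (0 : ℝ) < 54 * V)).1 hm_le
    linarith
  have hm : 54 * (m : ℝ) * (blockLaw y δ hy0.le I).var ≤ ((R' : ℕ) : ℝ) ^ 2 * (blockLaw y δ hy0.le I).mass := by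
    have h1 : 54 * (m : ℝ) * (blockLaw y δ hy0.le I).var ≤ 54 * (m : ℝ) * V :=
      mul_le_mul_of_nonneg_left hvarV (by positivity)
    have h2 : ((R' : ℕ) : ℝ) ^ 2 ≤ ((R' : ℕ) : ℝ) ^ 2 * (blockLaw y δ hy0.le I).mass :=
      le_mul_of_one_le_right (sq_nonneg _) hmass1
    linarith
  have h5 : 5 ≤ (blockLaw y δ hy0.le I).mass ^ m :=
    calc (5 : ℝ) ≤ 1 + (m : ℝ) * (δ / 2) := by linarith
      _ ≤ (1 + δ / 2) ^ m := one_add_mul_le_pow (by linarith) m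
      _ ≤ (blockLaw y δ hy0.le I).mass ^ m := pow_le_pow_left₀ (by linarith) hmass2 m
  have hns := StepLaw.not_summable_tubeMassK (blockLaw y δ hy0.le I) hmass1 hRR' hR'0 hm1 hm h5
  have hS3 : ∀ K : ℕ, ∑ k ∈ range K, (blockLaw y δ hy0.le I).tubeMassK k R ≤
      ∑ N ∈ range (K * I + 1), Real.exp (-(N : ℝ) * pulledBridgeFreeEnergy 2 y) * Real.exp (δ * N) *
        pulledStripZ T N y := fun K => stub_tube_le_strip hy0.le hδ0 hRI K
  -- contradiction: eventual smallness of the strip partition function would make the tube masses summable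
  by_contra hcon
  rw [Filter.not_frequently] at hcon
  apply hns
  refine upper_contra (a := fun N : ℕ => Real.exp (-(N : ℝ) * pulledBridgeFreeEnergy 2 y) *
      Real.exp (δ * N) * pulledStripZ T N y) (I := I) hε (fun N => ?_)
    (fun k => StepLaw.tubeMassK_nonneg _ k R) hS3 ?_
  · exact mul_nonneg (mul_nonneg (Real.exp_pos _).le (Real.exp_pos _).le) (pulledStripZ_nonneg T N hy0.le)
  · filter_upwards [hcon] with N hN
    rw [not_le] at hN
    have heq : Real.exp (-(N : ℝ) * pulledBridgeFreeEnergy 2 y) * Real.exp (δ * N) *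
        Real.exp ((N : ℝ) * (pulledBridgeFreeEnergy 2 y - δ - ε)) = Real.exp (-ε * N) := by
      rw [← Real.exp_add, ← Real.exp_add]
      congr 1
      ring
    calc Real.exp (-(N : ℝ) * pulledBridgeFreeEnergy 2 y) * Real.exp (δ * N) * pulledStripZ T N y
        ≤ Real.exp (-(N : ℝ) * pulledBridgeFreeEnergy 2 y) * Real.exp (δ * N) *
            Real.exp ((N : ℝ) * (pulledBridgeFreeEnergy 2 y - δ - ε)) :=
          mul_le_mul_of_nonneg_left hN.le (by positivity)
      _ = Real.exp (-ε * N) := heq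

end Upper

/-! ### R51 at `y = 2` (kernel-checked composition through `pulledGap_two`'s inputs) -/

/-- **R51 at `y = 2`**: both strip-deficit bounds from the two gap-conditional theorems above with `L = 1250/351`,
`SAW.pulledBridgeZ_two_lower`. [cite: MadrasSlade1993, Theorem 8.2.1; BrakOwczarekRechnitzerWhittington2005, §6–§7; DaoudDeGennes1977 — quantitative form at y = 2, this file] -/
theorem stripDeficit_two :
    (∃ C : ℝ, ∃ T₀ : ℕ, StripDeficitUpper 2 C T₀) ∧ (∃ c : ℝ, 0 < c ∧ StripDeficitLower 2 c) := by
  refine ⟨stripDeficitUpper_of_gap (L := 1250 / 351) (by norm_num) (by norm_num) ?_ (by norm_num),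
    stripDeficitLower_of_gap (L := 1250 / 351) (by norm_num) (by norm_num) ?_ (by norm_num)⟩ <;>
  exact log_le_pulledBridgeFreeEnergy_of_exists (by norm_num) (by norm_num) pulledBridgeZ_two_lower

end Literature.Probability.RandomPlanarGeometry.SAW.Zd.StripDeficit
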